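import Literature.Barriers.NavierStokesRegularity.CriticalDataSmoothNonuniquenessThresholdAssembly
import Literature.Analysis.FluidPDE.CP25PerturbationPicard
import Literature.Analysis.FluidPDE.LacunaryVolterraResolvent
import Literature.Analysis.FluidPDE.ForcedOseenMildPeriodic
import Literature.Analysis.FluidPDE.OseenMildPeriodicClassical
import Literature.Analysis.FluidPDE.OseenDuhamelEnvelopeRestart
import Literature.Analysis.FluidPDE.OseenDuhamelEnvelopeDivFree
import Literature.Analysis.FluidPDE.PeriodicOseenEnvelopeMean
import Literature.Analysis.FluidPDE.PeriodicOseenHNegOne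
import Literature.Analysis.FluidPDE.LerayHopfMildH1
import Literature.Analysis.FluidPDE.OseenDuhamelWeightedHolder
import Literature.Analysis.FunctionSpaces.TorusHNegOnePairing
import Literature.Analysis.FunctionSpaces.TorusSupNormContinuity
import HarnessLib

/-!
# Coiculescu–Palasek 2025, Props. 4.2–4.3: the perturbation step PROVED (reduced form)

Sibling proof file of the barrier entry
`Literature/Barriers/NavierStokesRegularity/CriticalDataSmoothNonuniqueness` (D-0021; M. P.
Coiculescu, S. Palasek, *Non-uniqueness of smooth solutions of the Navier–Stokes equations from
critical data*, Invent. Math. 244 (2025), 165–219, arXiv:2503.14699, Thm. 1.2).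

The named fact `CoiculescuPalasek2025_perturbation` (Props. 4.2–4.3 abstracted to all Hölder
exponents, WITH the `Ċ^{1,κ}` slot of `‖w‖_X ≤ ε₁`) is refuted in the tree
(`not_CoiculescuPalasek2025_perturbation`). The assembly of Thm. 1.2 consumes only five conclusions
of the perturbation step (`CriticalDataSmoothNonuniqueness_of_principalParts_of_perturbationLe`,
`…ThresholdAssembly`): a classical solution `v + w`, zero mean of `w`, the `L^∞` slot
`t^{(1-α)/2}‖w(t)‖ ≤ ε₁`, `‖w(t)‖_{Ḣ⁻¹} → 0` and the pairings `∫⟪w(t), φ⟫ → 0`. This file PROVES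
that reduced perturbation step, for every Hölder exponent (the exponent only enters the
hypothesis bundle), following the printed proof at the level of sup norms:

1. (Prop. 4.2, the linearisation, and Prop. 4.3, the contraction — sup-norm level.) The
   correction is the fixed point `w = 𝒟[F] - B(ṽ,w) - B(w,ṽ) - B(w,w)` of the mild perturbation
   equation on `ℝ³ × (0,T_*]` (`B = B¹₀` the Oseen–Duhamel term, `ṽ` the lift of `v`,
   `𝒟[F] = -Σ B¹₀(e_j, F̃_{ij} e_i)`), produced by `CP25Picard.exists_perturbation_fixedPoint` in the
   class `‖w(t)‖_∞ ≤ ρ t^{α-1/2}` once the RESOLVENT of the linearisation is bounded on that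
   profile; the resolvent bound under the lacunary hypothesis (3.13b) with small slope `η` is
   `LacunaryVolterra.tsum_iterate_volterraK_powProfile_le` (the fractional Grönwall inequality of
   App. B, Lemma B.3, summed over entry times).
2. (§5 ¶1, "by standard regularity theory `u⁽ⁱ⁾` is smooth".) `u = ṽ + w` solves the Oseen
   integral equation from every base time `s > 0` (Duhamel formula for `v`,
   `Torus.lift_eq_forced_oseenMild`; restart law of the Duhamel terms,
   `oseenDuhamel_eq_heatExtension_add_of_envelope`), hence descends to a classical solution on the
   torus (`Torus.exists_isClassicalNSSolutionOn_of_oseenMild`, Koch–Nadirashvili–Seregin–Šverák).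
3. Zero mean (`Torus.integral_oseenDuhamel_repr_eq_zero_of_envelope`), the `L^∞` slot (the profile
   bound), `‖w(t)‖_{Ḣ⁻¹} ≲ t^α → 0` (`Torus.eHomSobolevSeminorm_neg_one_oseenDuhamel_repr_le`) and
   the pairings (`Torus.ofReal_abs_integral_inner_le_eHomSobolevSeminorm_mul`).

Main results:

* `CoiculescuPalasek2025_perturbation_reduced` — the reduced perturbation step, for all
  `α ∈ (0, 1/8)`, `κ ∈ (0, 1/2 - 4α)`, `K`, `C`;
* `CriticalDataSmoothNonuniqueness_of_principalParts` — the barrier fact from the principal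
  parts ALONE (hypothesis `hA` of `CoiculescuPalasek2025_construction_of_parts`: Def. 3.10,
  Prop. 3.13, Prop. 4.1 and the `v⁽ⁱ⁾`-only estimates of §5).

## References

* M. P. Coiculescu, S. Palasek, Invent. Math. 244 (2025), 165–219 = arXiv:2503.14699: Props.
  4.2–4.3, App. B, §5. [`CoiculescuPalasek2025`]
* G. Koch, N. Nadirashvili, G. Seregin, V. Šverák, Acta Math. 203 (2009) = arXiv:0709.3599, §4.
  [`KochNadirashviliSereginSverak2009`]
-/

noncomputable section

open MeasureTheory Set Filter Function TopologicalSpace UnitAddTorus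
open _root_.Topology
open scoped InnerProductSpace RealInnerProductSpace NNReal ENNReal

namespace Literature.Barriers.NavierStokesRegularity

open Literature.Analysis.FunctionSpaces Literature.Analysis.FluidPDE Literature.Analysis
open CoiculescuPalasek2025

namespace CoiculescuPalasek2025

/-- Local notation for physical space `ℝ³`. -/
local notation "ℝ³" => EuclideanSpace ℝ (Fin 3)
/-- Local notation for the flat torus `𝕋³`. -/
local notation "𝕋³" => UnitAddTorus (Fin 3)

/-! ## Generic helpers -/

section Helpers

variable {X : Type*} [NormedAddCommGroup X] [MeasurableSpace X] [BorelSpace X]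

/-- **Extension by zero of a field whose space–time lift is continuous on `S × ℝ³` is jointly
measurable**: `(τ, y) ↦ 𝟙_S(τ) u(τ)(proj y)`. [folklore] -/
theorem measurable_uncurry_extend {S : Set ℝ} [DecidablePred (· ∈ S)] (hS : MeasurableSet S)
    {u : ℝ → 𝕋³ → X}
    (hu : ContinuousOn (fun p : ℝ × ℝ³ => u p.1 (Torus.proj p.2)) (S ×ˢ univ)) :
    Measurable (uncurry fun (τ : ℝ) (y : ℝ³) => if τ ∈ S then u τ (Torus.proj y) else 0) := by
  classical
  set f : ℝ × ℝ³ → X := uncurry fun (τ : ℝ) (y : ℝ³) => if τ ∈ S then u τ (Torus.proj y) else 0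
  have hset : MeasurableSet (S ×ˢ (univ : Set ℝ³)) := hS.prod MeasurableSet.univ
  refine measurable_of_restrict_of_restrict_compl hset ?_ ?_
  · -- on `S × ℝ³` the function is the continuous space–time lift
    have hc : ContinuousOn f (S ×ˢ univ) := by
      refine hu.congr fun p hp => ?_
      simp only [f, uncurry, if_pos (mem_prod.1 hp).1]
    exact (continuousOn_iff_continuous_restrict.1 hc).measurable
  · have h0 : (S ×ˢ (univ : Set ℝ³))ᶜ.restrict f = fun _ => 0 := by
      funext p
      have hp : p.1.1 ∉ S := fun h => p.2 (mk_mem_prod h (mem_univ _))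
      simp only [restrict_apply, f, uncurry, if_neg hp]
    rw [h0]
    exact measurable_const

omit [NormedAddCommGroup X] [MeasurableSpace X] [BorelSpace X] in
/-- Extension by zero of a real function continuous on a measurable set is measurable. [folklore] -/
theorem measurable_extend_real {S : Set ℝ} [DecidablePred (· ∈ S)] (hS : MeasurableSet S) {φ : ℝ → ℝ}
    (hφ : ContinuousOn φ S) : Measurable fun t => if t ∈ S then φ t else 0 := by
  classical
  refine measurable_of_restrict_of_restrict_compl hS ?_ ?_
  · have hc : ContinuousOn (fun t => if t ∈ S then φ t else 0) S :=
      hφ.congr fun t ht => by simp only [if_pos ht]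
    exact (continuousOn_iff_continuous_restrict.1 hc).measurable
  · have h0 : Sᶜ.restrict (fun t => if t ∈ S then φ t else 0) = fun _ => 0 := by
      funext t; simp only [restrict_apply, if_neg (show (t : ℝ) ∉ S from t.2)]
    rw [h0]; exact measurable_const

omit [NormedAddCommGroup X] [MeasurableSpace X] [BorelSpace X] in
/-- **Additivity of weak divergence-freeness** for locally integrable (here: bounded measurable)
fields: the pairings `∫⟪uᵢ, ∇θ⟫` are each integrable. [folklore] -/
theorem isWeaklyDivFree_add_of_bound {u₁ u₂ : ℝ³ → ℝ³} (h₁ : IsWeaklyDivFree u₁)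
    (h₂ : IsWeaklyDivFree u₂) (hm₁ : AEStronglyMeasurable u₁ volume)
    (hm₂ : AEStronglyMeasurable u₂ volume) {M₁ M₂ : ℝ} (hb₁ : ∀ y, ‖u₁ y‖ ≤ M₁)
    (hb₂ : ∀ y, ‖u₂ y‖ ≤ M₂) : IsWeaklyDivFree (u₁ + u₂) := by
  intro θ hθ
  have hθ1 : ContDiff ℝ 1 θ := hθ.contDiff.of_le (by exact_mod_cast le_top)
  have hgc : Continuous (gradient θ) := continuous_gradient_of_contDiff hθ1
  have hgs : HasCompactSupport (gradient θ) :=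
    (hθ.hasCompactSupport.fderiv (𝕜 := ℝ)).comp_left (g := (InnerProductSpace.toDual ℝ ℝ³).symm)
      (map_zero _)
  have hgi : Integrable (gradient θ) volume := hgc.integrable_of_hasCompactSupport hgs
  have hint : ∀ {u : ℝ³ → ℝ³} {M : ℝ}, AEStronglyMeasurable u volume → (∀ y, ‖u y‖ ≤ M) →
      Integrable (fun y => ⟪u y, gradient θ y⟫) volume := by
    intro u M hm hb
    refine Integrable.mono' (hgi.norm.const_mul M) (hm.inner hgc.aestronglyMeasurable)
      (Eventually.of_forall fun y => ?_)
    calc ‖⟪u y, gradient θ y⟫‖ ≤ ‖u y‖ * ‖gradient θ y‖ := norm_inner_le_norm _ _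
      _ ≤ M * ‖gradient θ y‖ := mul_le_mul_of_nonneg_right (hb y) (norm_nonneg _)
  have e : (fun y => ⟪(u₁ + u₂) y, gradient θ y⟫) =
      fun y => ⟪u₁ y, gradient θ y⟫ + ⟪u₂ y, gradient θ y⟫ := by
    funext y; simp only [Pi.add_apply, inner_add_left]
  rw [e, integral_add (hint hm₁ hb₁) (hint hm₂ hb₂), h₁ θ hθ, h₂ θ hθ, add_zero]

omit [NormedAddCommGroup X] [MeasurableSpace X] [BorelSpace X] in
/-- Weak divergence-freeness of `-u`. [folklore] -/
theorem isWeaklyDivFree_neg {u : ℝ³ → ℝ³} (h : IsWeaklyDivFree u) : IsWeaklyDivFree (-u) := by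
  intro θ hθ
  have e : (fun y => ⟪(-u) y, gradient θ y⟫) = fun y => -⟪u y, gradient θ y⟫ := by
    funext y; simp only [Pi.neg_apply, inner_neg_left]
  rw [e, integral_neg, h θ hθ, neg_zero]

end Helpers

/-! ## The scalar inputs of an approximate solution -/

section Inputs

variable {T α : ℝ} {κ : ℝ≥0} {K : ℕ → ℝ} {C η ε₀ : ℝ}
  {v : ℝ → 𝕋³ → ℝ³} {F : ℝ → 𝕋³ → (Fin 3 → Fin 3 → ℝ)} {π : ℝ → 𝕋³ → ℝ}

/-- The sup norm dominates pointwise: `‖v(t,x)‖ ≤ ‖v(t)‖_∞` on `(0,T]`. [folklore] -/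
theorem IsApproximateSolution.norm_slice_le_toReal_eSupNorm (h : IsApproximateSolution T α κ K C η ε₀ v F π)
    {t : ℝ} (ht : t ∈ Ioc 0 T) (x : 𝕋³) : ‖v t x‖ ≤ (eSupNorm (v t)).toReal :=
  Torus.norm_le_toReal_eSupNorm (h.continuous_slice ht) x

/-- **(3.13a), `m = 0`, for the sup norm**: `√t ‖v(t)‖_∞ ≤ |K₀|` on `(0,T]`.
[cite: CoiculescuPalasek2025, Prop. 3.13 (3.13a)] -/
theorem IsApproximateSolution.sqrt_mul_toReal_eSupNorm_le_abs
    (h : IsApproximateSolution T α κ K C η ε₀ v F π) {t : ℝ} (ht : t ∈ Ioc 0 T) :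
    Real.sqrt t * (eSupNorm (v t)).toReal ≤ |K 0| := by
  have hst : 0 < Real.sqrt t := Real.sqrt_pos.2 ht.1
  have hsup : eSupNorm (v t) ≤ ENNReal.ofReal (|K 0| / Real.sqrt t) := by
    unfold eSupNorm
    refine iSup_le fun x => ?_
    rw [← ofReal_norm]
    refine ENNReal.ofReal_le_ofReal ?_
    rw [le_div_iff₀ hst, mul_comm]
    exact h.sqrt_mul_norm_le ht x
  have h1 : (eSupNorm (v t)).toReal ≤ |K 0| / Real.sqrt t :=
    ENNReal.toReal_le_of_le_ofReal (by positivity) hsup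
  calc Real.sqrt t * (eSupNorm (v t)).toReal ≤ Real.sqrt t * (|K 0| / Real.sqrt t) :=
        mul_le_mul_of_nonneg_left h1 hst.le
    _ = |K 0| := mul_div_cancel₀ _ hst.ne'

/-- The constant of (3.13b) is nonnegative (take `t₁ = t₂`). [folklore] -/
theorem IsApproximateSolution.lacunary_const_nonneg (h : IsApproximateSolution T α κ K C η ε₀ v F π)
    (hT : 0 < T) : 0 ≤ C := by
  have h1 := h.lacunary_le T T hT le_rfl le_rfl
  simp only [intervalIntegral.integral_same, div_self hT.ne', Real.log_one, mul_zero, add_zero,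
    mul_one] at h1
  exact h1

/-- **Prop. 4.1 for the sup norm of the residual**: `‖F(t,x)‖ ≤ ε₀ t^{α-1}` on `(0,T]`
(`0 ≤ ε₀`). [cite: CoiculescuPalasek2025, Prop. 4.1 (‖F‖_Y ≤ ε₀)] -/
theorem IsApproximateSolution.norm_residual_le (h : IsApproximateSolution T α κ K C η ε₀ v F π)
    (hε₀ : 0 ≤ ε₀) {t : ℝ} (ht : t ∈ Ioc 0 T) (x : 𝕋³) : ‖F t x‖ ≤ ε₀ * t ^ (α - 1) := by
  have hr := h.residual_le t ht
  have htp : 0 < t ^ (1 - α) := Real.rpow_pos_of_pos ht.1 _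
  have h1 : ENNReal.ofReal (t ^ (1 - α)) * ‖F t x‖ₑ ≤ ENNReal.ofReal ε₀ :=
    le_trans (le_trans (mul_le_mul_right (enorm_le_eSupNorm (F t) x) _) le_self_add) hr
  rw [← ofReal_norm, ← ENNReal.ofReal_mul htp.le, ENNReal.ofReal_le_ofReal_iff hε₀] at h1
  have h2 : ‖F t x‖ ≤ ε₀ / t ^ (1 - α) := by rw [le_div_iff₀ htp, mul_comm]; exact h1
  refine h2.trans_eq ?_
  rw [div_eq_mul_inv, ← Real.rpow_neg ht.1.le]
  congr 2; ring

/-- Entries of the residual: `|F(t,x)ᵢⱼ| ≤ ε₀ t^{α-1}` on `(0,T]`. [folklore] -/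
theorem IsApproximateSolution.abs_residual_apply_le (h : IsApproximateSolution T α κ K C η ε₀ v F π)
    (hε₀ : 0 ≤ ε₀) {t : ℝ} (ht : t ∈ Ioc 0 T) (x : 𝕋³) (i j : Fin 3) :
    |F t x i j| ≤ ε₀ * t ^ (α - 1) :=
  ((Real.norm_eq_abs _).symm.le.trans ((norm_le_pi_norm (F t x i) j).trans
    (norm_le_pi_norm (F t x) i))).trans (h.norm_residual_le hε₀ ht x)

end Inputs

/-! ## The fields of the mild perturbation equation -/

section Fields

/-- The sup-norm profile `ν(t) = 𝟙_{(0,T]}(t) ‖v(t)‖_{L^∞}` of the principal part (the function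
`t ↦ ‖v(t)‖_∞` of (3.13a)–(3.13b), extended by `0`). [cite: CoiculescuPalasek2025, Prop. 3.13] -/
def supProfile (T : ℝ) (v : ℝ → 𝕋³ → ℝ³) (t : ℝ) : ℝ :=
  if t ∈ Ioc 0 T then (eSupNorm (v t)).toReal else 0

/-- The lifted principal part, cut off outside `(0,T]`: `ṽ(τ)(y) = 𝟙_{(0,T]}(τ) v(τ)(proj y)`.
[cite: CoiculescuPalasek2025, §4.3 (v⁽ⁱ⁾ in the perturbation equation)] -/
def liftCut (T : ℝ) (v : ℝ → 𝕋³ → ℝ³) (τ : ℝ) (y : ℝ³) : ℝ³ :=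
  if τ ∈ Ioc 0 T then v τ (Torus.proj y) else 0

/-- The constant unit field `e_{p.2}` (left slot of the divergence pair `(e_j, F_{ij} e_i)`).
[folklore] -/
def unitField (p : Fin 3 × Fin 3) (_τ : ℝ) (_y : ℝ³) : ℝ³ :=
  EuclideanSpace.single p.2 (1 : ℝ)

/-- The lifted residual entry field `F̃_{ij}(τ)(z) e_i`, cut off outside `(0,T]` (right slot of the
divergence pair; `Σ_{(i,j)} B(e_j, F̃_{ij}e_i) = ∫ e^{(t-τ)Δ}ℙ div F̃`).
[cite: CoiculescuPalasek2025, §4.1 eq. (4.1) (the force -ℙ div F)] -/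
def residualField (T : ℝ) (F : ℝ → 𝕋³ → (Fin 3 → Fin 3 → ℝ)) (p : Fin 3 × Fin 3) (τ : ℝ)
    (z : ℝ³) : ℝ³ :=
  (if τ ∈ Ioc 0 T then F τ (Torus.proj z) p.1 p.2 else 0) • EuclideanSpace.single p.1 (1 : ℝ)

/-- **The forcing of the perturbation equation**, `𝒟[F](t) = ∫₀ᵗ e^{(t-τ)Δ}ℙ div F̃(τ) dτ`
(the principal part solves Navier–Stokes with the force `-ℙ div F`, (4.1), so the correction
must absorb `+ℙ div F`), written through the divergence pairs: `Σ_{(i,j)} B¹₀(e_j, F̃_{ij} e_i)(t)`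
(`B¹₀(a,b) = ∫₀ᵗ e^{(t-τ)Δ}ℙ∇·(a ⊗ b)`). [cite: CoiculescuPalasek2025, §4.3 (w = 𝒟[F] - …), §4.2 (the operator 𝒟)] -/
def forcing (T : ℝ) (F : ℝ → 𝕋³ → (Fin 3 → Fin 3 → ℝ)) (t : ℝ) (y : ℝ³) : ℝ³ :=
  ∑ p : Fin 3 × Fin 3, oseenDuhamel 1 0 (unitField p) (residualField T F p) t y

/-- **A correction in the class `‖w(t)‖_∞ ≤ ρ t^{α-1/2}`**: a jointly measurable, lattice-periodic
field vanishing outside `(0,T]` which solves the mild perturbation equation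
`w = 𝒟[F] - B(ṽ,w) - B(w,ṽ) - B(w,w)` pointwise on `(0,T]` (Prop. 4.3: the fixed point in the
ball of `X`, at the level of the `L^∞` slot of `X`). [cite: CoiculescuPalasek2025, Prop. 4.3] -/
structure IsCorrection (T α ρ : ℝ) (v : ℝ → 𝕋³ → ℝ³) (F : ℝ → 𝕋³ → (Fin 3 → Fin 3 → ℝ))
    (w : ℝ → ℝ³ → ℝ³) : Prop where
  /-- Joint measurability. -/
  measurable : Measurable (uncurry w)
  /-- The profile bound `‖w(t)‖_∞ ≤ ρ t^{α-1/2}`. -/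
  norm_le : ∀ t ∈ Ioc 0 T, ∀ x, ‖w t x‖ ≤ ρ * t ^ (α - 1 / 2)
  /-- The mild perturbation equation. -/
  eq : ∀ t ∈ Ioc 0 T, ∀ x, w t x = forcing T F t x - oseenDuhamel 1 0 (liftCut T v) w t x -
    oseenDuhamel 1 0 w (liftCut T v) t x - oseenDuhamel 1 0 w w t x
  /-- `w` vanishes outside `(0,T]`. -/
  zero_off : ∀ t, t ∉ Ioc 0 T → ∀ x, w t x = 0
  /-- Lattice periodicity of the slices. -/
  periodic : ∀ t, Torus.IsLatticePeriodic (w t)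

variable {T α : ℝ} {κ : ℝ≥0} {K : ℕ → ℝ} {C η ε₀ : ℝ}
  {v : ℝ → 𝕋³ → ℝ³} {F : ℝ → 𝕋³ → (Fin 3 → Fin 3 → ℝ)} {π : ℝ → 𝕋³ → ℝ}

/-- Unfolding `supProfile` on `(0,T]`. [folklore] -/
theorem supProfile_of_mem' {t : ℝ} (ht : t ∈ Ioc 0 T) : supProfile T v t = (eSupNorm (v t)).toReal := by
  simp only [supProfile, if_pos ht]

/-- `0 ≤ ν`. [folklore] -/
theorem supProfile_nonneg' (t : ℝ) : 0 ≤ supProfile T v t := by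
  simp only [supProfile]; split_ifs
  · exact ENNReal.toReal_nonneg
  · exact le_rfl

/-- `ν` is measurable. [folklore] -/
theorem IsApproximateSolution.measurable_supProfile' (h : IsApproximateSolution T α κ K C η ε₀ v F π) :
    Measurable (supProfile T v) :=
  measurable_extend_real measurableSet_Ioc h.solution.smooth_velocity.continuousOn_toReal_eSupNorm

/-- `ν` is continuous on `(0,T]`. [folklore] -/
theorem IsApproximateSolution.continuousOn_supProfile' (h : IsApproximateSolution T α κ K C η ε₀ v F π) :
    ContinuousOn (supProfile T v) (Ioc 0 T) :=
  h.solution.smooth_velocity.continuousOn_toReal_eSupNorm.congr fun t ht => by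
    simp only [supProfile, if_pos ht]

/-- `√t ν(t) ≤ |K₀|` on `(0,T]`. [cite: CoiculescuPalasek2025, Prop. 3.13 (3.13a)] -/
theorem IsApproximateSolution.sqrt_mul_supProfile_le (h : IsApproximateSolution T α κ K C η ε₀ v F π)
    {t : ℝ} (ht : t ∈ Ioc 0 T) : Real.sqrt t * supProfile T v t ≤ |K 0| := by
  rw [supProfile_of_mem' ht]; exact h.sqrt_mul_toReal_eSupNorm_le_abs ht

/-- `ν(t) ≤ |K₀| t^{-1/2}` on `(0,T]`. [cite: CoiculescuPalasek2025, Prop. 3.13 (3.13a)] -/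
theorem IsApproximateSolution.supProfile_le (h : IsApproximateSolution T α κ K C η ε₀ v F π)
    {t : ℝ} (ht : t ∈ Ioc 0 T) : supProfile T v t ≤ |K 0| * t ^ (-(1 / 2 : ℝ)) := by
  have hst : 0 < Real.sqrt t := Real.sqrt_pos.2 ht.1
  have h1 := h.sqrt_mul_supProfile_le ht
  rw [Real.rpow_neg ht.1.le, ← Real.sqrt_eq_rpow, ← div_eq_mul_inv, le_div_iff₀ hst, mul_comm]
  exact h1

/-- **The lifted cut-off principal part is jointly measurable.** [folklore] -/
theorem IsApproximateSolution.measurable_liftCut (h : IsApproximateSolution T α κ K C η ε₀ v F π) :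
    Measurable (uncurry (liftCut T v)) :=
  measurable_uncurry_extend measurableSet_Ioc h.solution.smooth_velocity.continuousOn_stLift

/-- `‖ṽ(τ)(y)‖ ≤ ν(τ)` on `(0,T]`. [folklore] -/
theorem IsApproximateSolution.norm_liftCut_le (h : IsApproximateSolution T α κ K C η ε₀ v F π)
    {t : ℝ} (ht : t ∈ Ioc 0 T) (y : ℝ³) : ‖liftCut T v t y‖ ≤ supProfile T v t := by
  simp only [liftCut, supProfile, if_pos ht]
  exact h.norm_slice_le_toReal_eSupNorm ht _

/-- `ṽ(τ) = lift v(τ)` on `(0,T]`. [folklore] -/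
theorem liftCut_of_mem {t : ℝ} (ht : t ∈ Ioc 0 T) : liftCut T v t = Torus.lift (v t) := by
  funext y; simp only [liftCut, if_pos ht, Torus.lift_apply]

/-- `ṽ(τ) = 0` off `(0,T]`. [folklore] -/
theorem liftCut_of_not_mem {t : ℝ} (ht : t ∉ Ioc 0 T) (y : ℝ³) : liftCut T v t y = 0 := by
  simp only [liftCut, if_neg ht]

/-- The slices of `ṽ` are lattice periodic. [folklore] -/
theorem isLatticePeriodic_liftCut (t : ℝ) : Torus.IsLatticePeriodic (liftCut T v t) := by
  intro j y
  by_cases ht : t ∈ Ioc 0 T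
  · rw [liftCut_of_mem ht]; exact Torus.isLatticePeriodic_lift (v t) j y
  · rw [liftCut_of_not_mem ht, liftCut_of_not_mem ht]

/-- **The residual entry fields are jointly measurable.** [folklore] -/
theorem IsApproximateSolution.measurable_residualField (h : IsApproximateSolution T α κ K C η ε₀ v F π)
    (p : Fin 3 × Fin 3) : Measurable (uncurry (residualField T F p)) := by
  have hc : ContinuousOn (fun q : ℝ × ℝ³ => (fun τ x => F τ x p.1 p.2) q.1 (Torus.proj q.2))
      (Ioc 0 T ×ˢ univ) :=
    ((continuous_apply p.2).comp_continuousOn ((continuous_apply p.1).comp_continuousOn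
      h.smooth_residual.continuousOn_stLift))
  have hm := measurable_uncurry_extend (u := fun τ x => F τ x p.1 p.2) measurableSet_Ioc hc
  have e : uncurry (residualField T F p) = fun q : ℝ × ℝ³ =>
      (uncurry (fun (τ : ℝ) (y : ℝ³) => if τ ∈ Ioc 0 T then (fun τ x => F τ x p.1 p.2) τ (Torus.proj y) else 0) q) •
        EuclideanSpace.single p.1 (1 : ℝ) := by
    funext q; simp only [uncurry, residualField]
  rw [e]
  exact hm.smul measurable_const

/-- `‖F̃_{ij}(τ)(z) e_i‖ ≤ ε₀ τ^{α-1}` on `(0,T]`. [cite: CoiculescuPalasek2025, Prop. 4.1] -/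
theorem IsApproximateSolution.norm_residualField_le (h : IsApproximateSolution T α κ K C η ε₀ v F π)
    (hε₀ : 0 ≤ ε₀) (p : Fin 3 × Fin 3) {t : ℝ} (ht : t ∈ Ioc 0 T) (z : ℝ³) :
    ‖residualField T F p t z‖ ≤ ε₀ * t ^ (α - 1) := by
  simp only [residualField, if_pos ht, norm_smul, PiLp.norm_single, norm_one, mul_one,
    Real.norm_eq_abs]
  exact h.abs_residual_apply_le hε₀ ht _ p.1 p.2

/-- `F̃_{ij}(τ) e_i = 0` off `(0,T]`. [folklore] -/
theorem residualField_of_not_mem (p : Fin 3 × Fin 3) {t : ℝ} (ht : t ∉ Ioc 0 T) (z : ℝ³) :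
    residualField T F p t z = 0 := by
  simp only [residualField, if_neg ht, zero_smul]

/-- On `(0,T]` the residual entry field is the (uncut) lifted field of
`Torus.lift_eq_forced_oseenMild`. [folklore] -/
theorem residualField_of_mem (p : Fin 3 × Fin 3) {t : ℝ} (ht : t ∈ Ioc 0 T) :
    residualField T F p t = fun z => F t (Torus.proj z) p.1 p.2 • EuclideanSpace.single p.1 (1 : ℝ) := by
  funext z; simp only [residualField, if_pos ht]

/-- The slices of the residual entry fields are lattice periodic. [folklore] -/
theorem residualField_add_single (p : Fin 3 × Fin 3) (t : ℝ) (j : Fin 3) (z : ℝ³) :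
    residualField T F p t (z + EuclideanSpace.single j 1) = residualField T F p t z := by
  have h1 := Torus.isLatticePeriodic_lift (fun x => F t x p.1 p.2) j z
  simp only [Torus.lift_apply] at h1
  simp only [residualField, h1]

/-- `‖e_{p.2}‖ ≤ 1`. [folklore] -/
theorem norm_unitField_le (p : Fin 3 × Fin 3) (τ : ℝ) (y : ℝ³) : ‖unitField p τ y‖ ≤ 1 := by
  simp only [unitField, PiLp.norm_single, norm_one, le_rfl]

/-- The unit field is jointly measurable (constant). [folklore] -/
theorem measurable_unitField (p : Fin 3 × Fin 3) : Measurable (uncurry (unitField p)) :=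
  measurable_const

/-- **The envelope of the forcing pairs**: `(t-τ)^{-1/2} · 1 · ε₀τ^{α-1}` is integrable on `(t₀,t)`
(`0 ≤ t₀`, `0 < t`, `0 < α`), with `∫₀ᵗ ≤ ε₀ (2/α + 4) t^{α-1/2}`. [folklore] -/
theorem integrableOn_forcing_envelope {t₀ t α ε₀ : ℝ} (ht₀ : 0 ≤ t₀) (ht : 0 < t) (hα : 0 < α)
    (hα1 : α ≤ 1) :
    IntegrableOn (fun τ => (t - τ) ^ (-(1 / 2 : ℝ)) * (1 * (ε₀ * τ ^ (α - 1)))) (Ioo t₀ t) ∧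
      ∫ τ in Ioo 0 t, (t - τ) ^ (-(1 / 2 : ℝ)) * (1 * (ε₀ * τ ^ (α - 1))) ≤
        |ε₀| * ((2 / α + 4) * t ^ (α - 1 / 2)) := by
  obtain ⟨hint, hle⟩ := setIntegral_abel_rpow_rpow_le (a := 1 / 2) (b := 1 - α) (t := t)
    (by norm_num) (by norm_num) (by linarith) (by linarith) ht
  have e1 : (fun τ : ℝ => (t - τ) ^ (-(1 / 2 : ℝ)) * (1 * (ε₀ * τ ^ (α - 1)))) =
      fun τ => ε₀ * ((t - τ) ^ (-(1 / 2 : ℝ)) * τ ^ (-(1 - α))) := by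
    funext τ; rw [show (-(1 - α) : ℝ) = α - 1 by ring]; ring
  rw [e1]
  refine ⟨(hint.mono_set (Ioo_subset_Ioo_left ht₀)).const_mul ε₀, ?_⟩
  rw [integral_const_mul]
  have e2 : (1 : ℝ) - 1 / 2 - (1 - α) = α - 1 / 2 := by ring
  have e3 : (2 : ℝ) / (1 - (1 - α)) + 2 / (1 - 1 / 2) = 2 / α + 4 := by
    rw [show (1 : ℝ) - (1 - α) = α by ring]; norm_num
  rw [e2, e3] at hle
  have hI0 : 0 ≤ ∫ τ in Ioo 0 t, (t - τ) ^ (-(1 / 2 : ℝ)) * τ ^ (-(1 - α)) :=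
    setIntegral_nonneg measurableSet_Ioo fun τ hτ => mul_nonneg
      (Real.rpow_nonneg (by linarith [hτ.2]) _) (Real.rpow_nonneg hτ.1.le _)
  calc ε₀ * ∫ τ in Ioo 0 t, (t - τ) ^ (-(1 / 2 : ℝ)) * τ ^ (-(1 - α))
      ≤ |ε₀| * ∫ τ in Ioo 0 t, (t - τ) ^ (-(1 / 2 : ℝ)) * τ ^ (-(1 - α)) :=
        mul_le_mul_of_nonneg_right (le_abs_self _) hI0
    _ ≤ |ε₀| * ((2 / α + 4) * t ^ (α - 1 / 2)) := mul_le_mul_of_nonneg_left hle (abs_nonneg _)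

/-- **The forcing is jointly measurable.** [folklore] -/
theorem IsApproximateSolution.measurable_forcing (h : IsApproximateSolution T α κ K C η ε₀ v F π) :
    Measurable (uncurry (forcing T F)) := by
  have h1 : ∀ p : Fin 3 × Fin 3, Measurable (uncurry fun (t : ℝ) (y : ℝ³) =>
      oseenDuhamel 1 0 (unitField p) (residualField T F p) t y) := fun p =>
    measurable_uncurry_oseenDuhamel_from (measurable_unitField p) (h.measurable_residualField p) 1 0
  have e : uncurry (forcing T F) = fun q : ℝ × ℝ³ => ∑ p : Fin 3 × Fin 3,
      (uncurry fun (t : ℝ) (y : ℝ³) => oseenDuhamel 1 0 (unitField p) (residualField T F p) t y) q := by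
    funext q; simp only [uncurry, forcing]
  rw [e]
  exact Finset.measurable_sum _ fun p _ => h1 p

/-- **The bound of the forcing**: `‖𝒟[F](t)(y)‖ ≤ 9 C₀ (2/α + 4) ε₀ t^{α-1/2}` on `(0,T]`
(`C₀ = oseenSliceConst`: `‖N_σ[a,b]‖ ≤ C₀σ^{-1/2}‖a‖‖b‖`, and `∫₀ᵗ (t-τ)^{-1/2}τ^{α-1} ≤ (2/α+4)t^{α-1/2}`).
[cite: CoiculescuPalasek2025, proof of Prop. 4.3 (‖𝒟[F]‖_X ≲ ‖F‖_Y, Prop. 4.2)] -/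
theorem IsApproximateSolution.norm_forcing_le (h : IsApproximateSolution T α κ K C η ε₀ v F π)
    (hε₀ : 0 ≤ ε₀) (hα : 0 < α) (hα1 : α ≤ 1) {t : ℝ} (ht : t ∈ Ioc 0 T) (y : ℝ³) :
    ‖forcing T F t y‖ ≤
      9 * oseenSliceConst ℝ³ * (2 / α + 4) * ε₀ * t ^ (α - 1 / 2) := by
  have hC₀ : 0 ≤ oseenSliceConst ℝ³ := (oseenSliceConst_pos (E := ℝ³)).le
  have hterm : ∀ p : Fin 3 × Fin 3,
      ‖oseenDuhamel 1 0 (unitField p) (residualField T F p) t y‖ ≤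
        oseenSliceConst ℝ³ * (ε₀ * ((2 / α + 4) * t ^ (α - 1 / 2))) := by
    intro p
    obtain ⟨hint, hle⟩ := integrableOn_forcing_envelope (t₀ := 0) (ε₀ := ε₀) le_rfl ht.1 hα hα1
    rw [abs_of_nonneg hε₀] at hle
    refine (norm_oseenDuhamel_le_setIntegral (Ma := fun _ => (1 : ℝ)) (Mb := fun τ => ε₀ * τ ^ (α - 1))
      (fun τ _ z => norm_unitField_le p τ z)
      (fun τ hτ z => h.norm_residualField_le hε₀ p ⟨hτ.1, hτ.2.le.trans ht.2⟩ z) hint y).trans ?_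
    exact mul_le_mul_of_nonneg_left hle hC₀
  calc ‖forcing T F t y‖ = ‖∑ p : Fin 3 × Fin 3, oseenDuhamel 1 0 (unitField p) (residualField T F p) t y‖ := by
        rw [forcing]
    _ ≤ ∑ p : Fin 3 × Fin 3, oseenSliceConst ℝ³ * (ε₀ * ((2 / α + 4) * t ^ (α - 1 / 2))) :=
        norm_sum_le_of_le _ fun p _ => hterm p
    _ = 9 * oseenSliceConst ℝ³ * (2 / α + 4) * ε₀ * t ^ (α - 1 / 2) := by
        rw [Finset.sum_const, Finset.card_univ, Fintype.card_prod, Fintype.card_fin, nsmul_eq_mul]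
        push_cast; ring

/-- The forcing is lattice periodic. [folklore] -/
theorem forcing_add_single (t : ℝ) (j : Fin 3) (y : ℝ³) :
    forcing T F t (y + EuclideanSpace.single j 1) = forcing T F t y := by
  simp only [forcing]
  refine Finset.sum_congr rfl fun p _ => ?_
  rw [← oseenDuhamel_comp_add_right 1 0 (unitField p) (residualField T F p) (EuclideanSpace.single j 1) t y]
  simp only [unitField, residualField_add_single]
  rfl

end Fields

/-! ## The constants -/

section Constants

/-- **The Picard constant `C₀`** of `CP25Picard.exists_perturbation_fixedPoint` on `ℝ³` (the
`L¹` constant of the Oseen kernel slice, `‖K(σ,·)‖_{L¹} ≤ C₀σ^{-1/2}`), chosen once.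
[cite: CoiculescuPalasek2025, proof of Prop. 4.2 (the constant of Lemma 2.2)] -/
def picardConst : ℝ :=
  Classical.choose (CP25Picard.exists_perturbation_fixedPoint (E := ℝ³))

/-- `C₀ > 0`. [folklore] -/
theorem picardConst_pos : 0 < picardConst :=
  (Classical.choose_spec (CP25Picard.exists_perturbation_fixedPoint (E := ℝ³))).1

/-- The Koch–Tataru constant fed to the resolvent bound: `K̄ = |K₀| + 1` (dominates
`√s (ν(s) + s^{α-1/2})` on `(0,1]`). [folklore] -/
def Kbar (K : ℕ → ℝ) : ℝ := |K 0| + 1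

/-- The lacunarity constant fed to the resolvent bound: `C̄ = max C 0 + (2|K₀|+1)/α + 1/(2α)`
(the constant of (3.13b) for the profile `ν + s^{α-1/2}` on `(0,1]`). [folklore] -/
def Cbar (K : ℕ → ℝ) (C α : ℝ) : ℝ := max C 0 + (2 * |K 0| + 1) / α + 1 / (2 * α)

/-- The Grönwall exponent `θ = c(1 + 2731 c² K̄) C̄`, `c = 2C₀`, of
`LacunaryVolterra.tsum_iterate_volterraK_powProfile_le`. [cite: CoiculescuPalasek2025, App. B Lemma B.3] -/
def theta (K : ℕ → ℝ) (C α : ℝ) : ℝ :=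
  2 * picardConst * (1 + 2731 * (2 * picardConst) ^ 2 * Kbar K) * Cbar K C α

/-- The resolvent bound `C_R = 2/α + 4 + 2Λ/α`, `Λ = 3c(10K̄ + √2 C̄)e^{3θ}`, of
`LacunaryVolterra.tsum_iterate_volterraK_powProfile_le`. [cite: CoiculescuPalasek2025, Prop. 4.2 (‖w‖_X ≤ C₂(…))] -/
def resolventBound (K : ℕ → ℝ) (C α : ℝ) : ℝ :=
  2 / α + 4 + 2 * (3 * (2 * picardConst * (10 * Kbar K + Real.sqrt 2 * Cbar K C α)) *
    Real.exp (3 * theta K C α)) / α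

/-- The forcing constant `c_g = 9 C₀' (2/α + 4)` (`‖𝒟[F](t)‖ ≤ c_g ε₀ t^{α-1/2}`).
[cite: CoiculescuPalasek2025, Prop. 4.2 (‖𝒟[F]‖_X ≲ ‖F‖_Y)] -/
def forcingConst (α : ℝ) : ℝ := 9 * oseenSliceConst ℝ³ * (2 / α + 4)

/-- `0 < K̄`. [folklore] -/
theorem Kbar_pos (K : ℕ → ℝ) : 0 < Kbar K := by
  unfold Kbar; positivity

/-- `0 ≤ C̄` for `0 < α`. [folklore] -/
theorem Cbar_nonneg (K : ℕ → ℝ) (C : ℝ) {α : ℝ} (hα : 0 < α) : 0 ≤ Cbar K C α := by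
  unfold Cbar
  have h1 : 0 ≤ max C 0 := le_max_right _ _
  positivity

/-- `0 ≤ θ` for `0 < α`. [folklore] -/
theorem theta_nonneg (K : ℕ → ℝ) (C : ℝ) {α : ℝ} (hα : 0 < α) : 0 ≤ theta K C α := by
  unfold theta
  have := picardConst_pos
  have := Kbar_pos K
  have := Cbar_nonneg K C hα
  positivity

/-- `0 < C_R` for `0 < α`. [folklore] -/
theorem resolventBound_pos (K : ℕ → ℝ) (C : ℝ) {α : ℝ} (hα : 0 < α) : 0 < resolventBound K C α := by
  unfold resolventBound
  have := picardConst_pos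
  have := Kbar_pos K
  have := Cbar_nonneg K C hα
  positivity

/-- `0 < c_g` for `0 < α`. [folklore] -/
theorem forcingConst_pos {α : ℝ} (hα : 0 < α) : 0 < forcingConst α := by
  unfold forcingConst
  have := oseenSliceConst_pos (E := ℝ³)
  positivity

end Constants

/-! ## The fixed point (Props. 4.2–4.3 at the level of sup norms) -/

section FixedPoint

variable {T α : ℝ} {κ : ℝ≥0} {K : ℕ → ℝ} {C η ε₀ : ℝ}
  {v : ℝ → 𝕋³ → ℝ³} {F : ℝ → 𝕋³ → (Fin 3 → Fin 3 → ℝ)} {π : ℝ → 𝕋³ → ℝ}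

/-- **(3.13b) for the augmented profile `ν̃ = ν + s^{α-1/2}`** on `(0,T]`, `T ≤ 1`:
`∫_{t₁}^{t₂} (ν̃² + s^{-1/2}ν̃) ≤ C̄ (1 + η log(t₂/t₁))` (the extra terms are
`≤ (2|K₀|+1) s^{α-1} + s^{2α-1}` by (3.13a), with integrals `≤ (2|K₀|+1)/α + 1/(2α)`).
[cite: CoiculescuPalasek2025, Prop. 3.13 (3.13a)–(3.13b)] -/
theorem IsApproximateSolution.lacunary_supProfile_add_rpow
    (h : IsApproximateSolution T α κ K C η ε₀ v F π) (hT1 : T ≤ 1) (hα : 0 < α) (hη : 0 ≤ η)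
    (t₁ t₂ : ℝ) (ht₁ : 0 < t₁) (h12 : t₁ ≤ t₂) (ht₂ : t₂ ≤ T) :
    ∫ s in t₁..t₂, ((supProfile T v s + s ^ (α - 1 / 2)) ^ 2 +
        s ^ (-(1 / 2 : ℝ)) * (supProfile T v s + s ^ (α - 1 / 2))) ≤
      Cbar K C α * (1 + η * Real.log (t₂ / t₁)) := by
  set ν : ℝ → ℝ := supProfile T v with hν
  have hmem : ∀ s ∈ Icc t₁ t₂, s ∈ Ioc 0 T := fun s hs => ⟨ht₁.trans_le hs.1, hs.2.trans ht₂⟩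
  have hL : 0 ≤ Real.log (t₂ / t₁) := Real.log_nonneg ((one_le_div ht₁).2 h12)
  have hL1 : 1 ≤ 1 + η * Real.log (t₂ / t₁) := le_add_of_nonneg_right (mul_nonneg hη hL)
  -- continuity on `[t₁, t₂]`
  have hνc : ContinuousOn ν (Icc t₁ t₂) := h.continuousOn_supProfile'.mono fun s hs => hmem s hs
  have hpc : ∀ e : ℝ, ContinuousOn (fun s : ℝ => s ^ e) (Icc t₁ t₂) := fun e =>
    continuousOn_id.rpow_const fun s hs => Or.inl (ht₁.trans_le hs.1).ne'
  have hii : ∀ {f : ℝ → ℝ}, ContinuousOn f (Icc t₁ t₂) → IntervalIntegrable f volume t₁ t₂ :=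
    fun hf => hf.intervalIntegrable_of_Icc h12
  -- the two majorants
  set g₁ : ℝ → ℝ := fun s => ν s ^ 2 + s ^ (-(1 / 2 : ℝ)) * ν s with hg₁
  set g₂ : ℝ → ℝ := fun s => (2 * |K 0| + 1) * s ^ (α - 1) + s ^ (2 * α - 1) with hg₂
  have hg₁c : ContinuousOn g₁ (Icc t₁ t₂) := (hνc.pow 2).add ((hpc _).mul hνc)
  have hg₂c : ContinuousOn g₂ (Icc t₁ t₂) := (continuousOn_const.mul (hpc _)).add (hpc _)
  have hfc : ContinuousOn (fun s => (ν s + s ^ (α - 1 / 2)) ^ 2 +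
      s ^ (-(1 / 2 : ℝ)) * (ν s + s ^ (α - 1 / 2))) (Icc t₁ t₂) :=
    ((hνc.add (hpc _)).pow 2).add ((hpc _).mul (hνc.add (hpc _)))
  -- pointwise comparison
  have hpt : ∀ s ∈ Icc t₁ t₂, (ν s + s ^ (α - 1 / 2)) ^ 2 + s ^ (-(1 / 2 : ℝ)) * (ν s + s ^ (α - 1 / 2)) ≤
      g₁ s + g₂ s := by
    intro s hs
    have hs0 : 0 < s := ht₁.trans_le hs.1
    have hνs : ν s ≤ |K 0| * s ^ (-(1 / 2 : ℝ)) := h.supProfile_le (hmem s hs)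
    have hν0 : 0 ≤ ν s := supProfile_nonneg' s
    have hp0 : 0 ≤ s ^ (α - 1 / 2) := Real.rpow_nonneg hs0.le _
    have e1 : s ^ (-(1 / 2 : ℝ)) * s ^ (α - 1 / 2) = s ^ (α - 1) := by
      rw [← Real.rpow_add hs0]; congr 1; ring
    have e2 : s ^ (α - 1 / 2) * s ^ (α - 1 / 2) = s ^ (2 * α - 1) := by
      rw [← Real.rpow_add hs0]; congr 1; ring
    have hcross : ν s * s ^ (α - 1 / 2) ≤ |K 0| * s ^ (α - 1) := by
      calc ν s * s ^ (α - 1 / 2) ≤ |K 0| * s ^ (-(1 / 2 : ℝ)) * s ^ (α - 1 / 2) :=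
            mul_le_mul_of_nonneg_right hνs hp0
        _ = |K 0| * s ^ (α - 1) := by rw [mul_assoc, e1]
    have hexp : (ν s + s ^ (α - 1 / 2)) ^ 2 + s ^ (-(1 / 2 : ℝ)) * (ν s + s ^ (α - 1 / 2)) =
        g₁ s + (2 * (ν s * s ^ (α - 1 / 2)) + s ^ (2 * α - 1) + s ^ (α - 1)) := by
      simp only [hg₁]; rw [← e1, ← e2]; ring
    rw [hexp]
    refine add_le_add le_rfl ?_
    simp only [hg₂]
    nlinarith [hcross, Real.rpow_nonneg hs0.le (α - 1)]
  -- the integrals of the majorants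
  have hI₁ : ∫ s in t₁..t₂, g₁ s ≤ max C 0 * (1 + η * Real.log (t₂ / t₁)) := by
    have heq : ∫ s in t₁..t₂, g₁ s =
        ∫ s in t₁..t₂, ((eSupNorm (v s)).toReal ^ 2 + s ^ (-(1 / 2 : ℝ)) * (eSupNorm (v s)).toReal) := by
      refine intervalIntegral.integral_congr fun s hs => ?_
      rw [uIcc_of_le h12] at hs
      simp only [hg₁, hν, supProfile_of_mem' (hmem s hs)]
    rw [heq]
    exact (h.lacunary_le t₁ t₂ ht₁ h12 ht₂).trans
      (mul_le_mul_of_nonneg_right (le_max_left _ _) (zero_le_one.trans hL1))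
  have hrpow : ∀ {e : ℝ}, 0 < e → ∫ s in t₁..t₂, s ^ (e - 1) ≤ 1 / e := by
    intro e he
    have h0 : (0 : ℝ) ∉ uIcc t₁ t₂ := by
      rw [uIcc_of_le h12]; exact fun h0 => (lt_irrefl (0 : ℝ)) (ht₁.trans_le h0.1)
    rw [integral_rpow (Or.inr ⟨ne_of_gt (by linarith), h0⟩)]
    have e1 : e - 1 + 1 = e := by ring
    rw [e1]
    have h1 : t₂ ^ e ≤ 1 := Real.rpow_le_one (ht₁.le.trans h12) (ht₂.trans hT1) he.le
    have h2 : 0 ≤ t₁ ^ e := Real.rpow_nonneg ht₁.le _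
    exact div_le_div_of_nonneg_right (by linarith) he.le
  have hI₂ : ∫ s in t₁..t₂, g₂ s ≤ (2 * |K 0| + 1) / α + 1 / (2 * α) := by
    simp only [hg₂]
    have i1 : IntervalIntegrable (fun s : ℝ => (2 * |K 0| + 1) * s ^ (α - 1)) volume t₁ t₂ :=
      hii (continuousOn_const.mul (hpc _))
    have i2 : IntervalIntegrable (fun s : ℝ => s ^ (2 * α - 1)) volume t₁ t₂ := hii (hpc _)
    rw [intervalIntegral.integral_add i1 i2, intervalIntegral.integral_const_mul]
    have h2α : ∫ s in t₁..t₂, s ^ (2 * α - 1) ≤ 1 / (2 * α) := hrpow (by linarith)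
    have hα' : ∫ s in t₁..t₂, s ^ (α - 1) ≤ 1 / α := hrpow hα
    have hK0 : 0 ≤ 2 * |K 0| + 1 := by positivity
    calc (2 * |K 0| + 1) * (∫ s in t₁..t₂, s ^ (α - 1)) + ∫ s in t₁..t₂, s ^ (2 * α - 1)
        ≤ (2 * |K 0| + 1) * (1 / α) + 1 / (2 * α) := add_le_add (mul_le_mul_of_nonneg_left hα' hK0) h2α
      _ = (2 * |K 0| + 1) / α + 1 / (2 * α) := by ring
  -- assembling
  calc ∫ s in t₁..t₂, ((ν s + s ^ (α - 1 / 2)) ^ 2 + s ^ (-(1 / 2 : ℝ)) * (ν s + s ^ (α - 1 / 2)))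
      ≤ ∫ s in t₁..t₂, (g₁ s + g₂ s) :=
        intervalIntegral.integral_mono_on h12 (hii hfc) (hii (hg₁c.add hg₂c)) hpt
    _ = (∫ s in t₁..t₂, g₁ s) + ∫ s in t₁..t₂, g₂ s := intervalIntegral.integral_add (hii hg₁c) (hii hg₂c)
    _ ≤ max C 0 * (1 + η * Real.log (t₂ / t₁)) + ((2 * |K 0| + 1) / α + 1 / (2 * α)) := add_le_add hI₁ hI₂
    _ ≤ max C 0 * (1 + η * Real.log (t₂ / t₁)) +
          ((2 * |K 0| + 1) / α + 1 / (2 * α)) * (1 + η * Real.log (t₂ / t₁)) := by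
        have h0 : 0 ≤ (2 * |K 0| + 1) / α + 1 / (2 * α) := by positivity
        nlinarith
    _ = Cbar K C α * (1 + η * Real.log (t₂ / t₁)) := by unfold Cbar; ring

/-- **Existence of the correction (Props. 4.2–4.3, sup-norm level).** For an approximate
solution on `(0,T]`, `T ≤ 1`, with `0 < α ≤ 1/2`, `ε₀ > 0`, lacunarity slope `η ≥ 0` so small
that `(3θ + 1)η ≤ α/2`, and residual so small that `c_g ε₀ C_R ≤ 1`, the mild perturbation
equation has a solution in the class `‖w(t)‖_∞ ≤ c_g ε₀ C_R t^{α-1/2}`: the resolvent of the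
linearisation is bounded on the profile `t^{α-1/2}` by `C_R`
(`LacunaryVolterra.tsum_iterate_volterraK_powProfile_le`, fed with (3.13a)–(3.13b) for
`ν̃ = ν + s^{α-1/2}`), and the Picard iteration of `CP25Picard.exists_perturbation_fixedPoint`
converges under it. [cite: CoiculescuPalasek2025, Props. 4.2–4.3 with App. B] -/
theorem IsApproximateSolution.exists_isCorrection (h : IsApproximateSolution T α κ K C η ε₀ v F π)
    (hT : 0 < T) (hT1 : T ≤ 1) (hα : 0 < α) (hα2 : α ≤ 1 / 2) (hε₀ : 0 < ε₀) (hη : 0 ≤ η)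
    (hηs : (3 * theta K C α + 1) * η ≤ α / 2)
    (hsmall : forcingConst α * ε₀ * resolventBound K C α ≤ 1) :
    ∃ w : ℝ → ℝ³ → ℝ³, IsCorrection T α (forcingConst α * ε₀ * resolventBound K C α) v F w := by
  have hC₀ := picardConst_pos
  set C₀ : ℝ := picardConst with hC₀def
  -- the profile `ν` and the augmented profile `ν̃`
  set ν : ℝ → ℝ := supProfile T v with hν
  set νt : ℝ → ℝ := fun s => ν s + s ^ (α - 1 / 2) with hνt
  have hνm : Measurable ν := h.measurable_supProfile'
  have hνc : ContinuousOn ν (Ioc 0 T) := h.continuousOn_supProfile'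
  have hν0 : ∀ s ∈ Ioc 0 T, 0 ≤ ν s := fun s _ => supProfile_nonneg' s
  have h313a : ∀ s ∈ Ioc 0 T, Real.sqrt s * ν s ≤ |K 0| := fun s hs => h.sqrt_mul_supProfile_le hs
  have hpc : ContinuousOn (fun s : ℝ => s ^ (α - 1 / 2)) (Ioc 0 T) :=
    continuousOn_id.rpow_const fun s hs => Or.inl hs.1.ne'
  have hνtm : Measurable νt := hνm.add (measurable_id.pow_const _)
  have hνtc : ContinuousOn νt (Ioc 0 T) := hνc.add hpc
  have hνt0 : ∀ s ∈ Ioc 0 T, 0 ≤ νt s := fun s hs =>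
    add_nonneg (hν0 s hs) (Real.rpow_nonneg hs.1.le _)
  have h313a' : ∀ s ∈ Ioc 0 T, Real.sqrt s * νt s ≤ Kbar K := by
    intro s hs
    have hs1 : s ≤ 1 := hs.2.trans hT1
    have e1 : Real.sqrt s * s ^ (α - 1 / 2) = s ^ α := by
      rw [Real.sqrt_eq_rpow, ← Real.rpow_add hs.1]; congr 1; ring
    simp only [hνt, Kbar]
    rw [mul_add, e1]
    exact add_le_add (h313a s hs) (Real.rpow_le_one hs.1.le hs1 hα.le)
  have h313b' := h.lacunary_supProfile_add_rpow hT1 hα hη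
  -- ### the resolvent bound
  have hc : 0 < 2 * C₀ := by positivity
  have hηs' : (3 * (2 * C₀ * (1 + 2731 * (2 * C₀) ^ 2 * Kbar K) * Cbar K C α) + 1) * η ≤ α / 2 := hηs
  have hR : ∀ {t : ℝ}, t ∈ Ioc 0 T →
      ∑' n, (LacunaryVolterra.volterraK (2 * C₀) νt)^[n] (LacunaryVolterra.powProfile α) t ≤
        ENNReal.ofReal (resolventBound K C α * t ^ (α - 1 / 2)) := fun ht =>
    LacunaryVolterra.tsum_iterate_volterraK_powProfile_le hc (Kbar_pos K) (Cbar_nonneg K C hα) hη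
      hνtm hνtc hνt0 h313a' h313b' hα (hα2.trans (by norm_num)) hηs' ht
  -- ### the Picard fixed point
  have hg₀ : 0 ≤ forcingConst α * ε₀ := (mul_pos (forcingConst_pos hα) hε₀).le
  have hR' : ∀ t ∈ Ioc 0 T, ∑' n, ((fun (f : ℝ → ℝ≥0∞) (t : ℝ) => ∫⁻ s in Ioo 0 t,
      ENNReal.ofReal (2 * C₀ * (t - s) ^ (-(1 / 2 : ℝ)) * (ν s + s ^ (α - 1 / 2))) * f s)^[n])
      (fun s => ENNReal.ofReal (s ^ (α - 1 / 2))) t ≤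
      ENNReal.ofReal (resolventBound K C α * t ^ (α - 1 / 2)) := fun t ht => hR ht
  obtain ⟨w, hwm, hwb, hweq, hw0, hwper⟩ :=
    (Classical.choose_spec (CP25Picard.exists_perturbation_fixedPoint (E := ℝ³))).2 hT hT1 hα hα2 hg₀
    (resolventBound_pos K C hα).le hsmall hνm hν0 h313a h.measurable_liftCut h.measurable_forcing
    (fun t ht y => h.norm_liftCut_le ht y)
    (fun t ht y => (h.norm_forcing_le hε₀.le hα (hα2.trans (by norm_num)) ht y).trans_eq (by
      simp only [forcingConst]))
    hR'
  refine ⟨w, ⟨hwm, fun t ht x => (hwb t ht x).trans_eq (by ring), hweq, hw0, fun t j y => ?_⟩⟩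
  exact hwper (EuclideanSpace.single j 1) (fun τ z => isLatticePeriodic_liftCut τ j z)
    (fun τ z => forcing_add_single τ j z) t y

end FixedPoint

/-! ## `u = ṽ + w` solves the Oseen integral equation from every base time -/

section Mild

variable {T α : ℝ} {κ : ℝ≥0} {K : ℕ → ℝ} {C η ε₀ : ℝ}
  {v : ℝ → 𝕋³ → ℝ³} {F : ℝ → 𝕋³ → (Fin 3 → Fin 3 → ℝ)} {π : ℝ → 𝕋³ → ℝ}

/-- Bounded measurable data are in `L^∞(ℝ³)`. [folklore] -/
theorem memLp_top_of_measurable_bound {f : ℝ³ → ℝ³} (hf : Measurable f) {M : ℝ}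
    (hM : ∀ y, ‖f y‖ ≤ M) : MemLp f ∞ (volume : Measure ℝ³) :=
  memLp_top_of_bound hf.aestronglyMeasurable M (Eventually.of_forall hM)

/-- `e^{σΔ} 0 = 0`. [folklore] -/
theorem heatExtension_zero_fun (σ : ℝ) (x : ℝ³) :
    UnboundedOperators.heatExtension (fun _ : ℝ³ => (0 : ℝ³)) σ x = 0 := by
  simp [UnboundedOperators.heatExtension_eq_integral_sub]

/-- Additivity of `e^{σΔ}` on `L^∞` vector data. [folklore] -/
theorem heatExtension_add_of_memLp_top {f g : ℝ³ → ℝ³} (hf : MemLp f ∞ (volume : Measure ℝ³))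
    (hg : MemLp g ∞ (volume : Measure ℝ³)) {σ : ℝ} (hσ : 0 < σ) (x : ℝ³) :
    UnboundedOperators.heatExtension (f + g) σ x =
      UnboundedOperators.heatExtension f σ x + UnboundedOperators.heatExtension g σ x := by
  have h1 := heatExtension_sub_of_memLp (hf.add hg) hg le_top hσ x
  have e : f + g - g = f := by funext y; simp
  rw [e] at h1
  rw [h1]; abel

/-- `e^{σΔ}(-g) = -e^{σΔ}g` on `L^∞` vector data. [folklore] -/
theorem heatExtension_neg_of_memLp_top {g : ℝ³ → ℝ³} (hg : MemLp g ∞ (volume : Measure ℝ³))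
    {σ : ℝ} (hσ : 0 < σ) (x : ℝ³) :
    UnboundedOperators.heatExtension (-g) σ x = -UnboundedOperators.heatExtension g σ x := by
  have h0 : MemLp (fun _ : ℝ³ => (0 : ℝ³)) ∞ (volume : Measure ℝ³) := MemLp.zero'
  have h1 := heatExtension_sub_of_memLp h0 hg le_top hσ x
  have e : (fun _ : ℝ³ => (0 : ℝ³)) - g = -g := by funext y; simp
  rw [e, heatExtension_zero_fun, zero_sub] at h1
  exact h1

/-- Finite additivity of `e^{σΔ}` on `L^∞` vector data. [folklore] -/
theorem heatExtension_sum_of_memLp_top {ι : Type*} (s : Finset ι) {g : ι → ℝ³ → ℝ³}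
    (hg : ∀ i ∈ s, MemLp (g i) ∞ (volume : Measure ℝ³)) {σ : ℝ} (hσ : 0 < σ) (x : ℝ³) :
    UnboundedOperators.heatExtension (fun z => ∑ i ∈ s, g i z) σ x =
      ∑ i ∈ s, UnboundedOperators.heatExtension (g i) σ x := by
  classical
  induction s using Finset.induction_on with
  | empty => simp [heatExtension_zero_fun]
  | insert a s ha ih =>
    have hga : MemLp (g a) ∞ (volume : Measure ℝ³) := hg a (Finset.mem_insert_self a s)
    have hgs : ∀ i ∈ s, MemLp (g i) ∞ (volume : Measure ℝ³) := fun i hi =>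
      hg i (Finset.mem_insert_of_mem hi)
    have hsum : MemLp (fun z => ∑ i ∈ s, g i z) ∞ (volume : Measure ℝ³) := memLp_finsetSum s hgs
    have e : (fun z => ∑ i ∈ insert a s, g i z) = g a + fun z => ∑ i ∈ s, g i z := by
      funext z; simp [Finset.sum_insert ha]
    rw [e, heatExtension_add_of_memLp_top hga hsum hσ x, ih hgs, Finset.sum_insert ha]

/-- **Envelope integrability for power profiles** (window version): if `M_a M_b ≤ P τ^{α-1}` on
`(0,t)` with `M_a, M_b ≥ 0` measurable, then `(t-τ)^{-1/2}M_aM_b` is integrable on `(t₀, t)` for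
every `0 ≤ t₀`. [folklore] -/
theorem integrableOn_envelope_window {t₀ t α P : ℝ} (ht₀ : 0 ≤ t₀) (ht : 0 < t) (hα : 0 < α)
    (hα1 : α ≤ 1) {Ma Mb : ℝ → ℝ} (hMam : Measurable Ma) (hMbm : Measurable Mb)
    (hMa0 : ∀ τ ∈ Ioo 0 t, 0 ≤ Ma τ) (hMb0 : ∀ τ ∈ Ioo 0 t, 0 ≤ Mb τ)
    (hP : ∀ τ ∈ Ioo 0 t, Ma τ * Mb τ ≤ P * τ ^ (α - 1)) :
    IntegrableOn (fun τ => (t - τ) ^ (-(1 / 2 : ℝ)) * (Ma τ * Mb τ)) (Ioo t₀ t) volume :=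
  (integrableOn_weight_of_profile ht hα hα1 hMam hMbm hMa0 hMb0 hP).mono_set (Ioo_subset_Ioo_left ht₀)

/-- **The principal part plus a correction solves the Oseen integral equation from every base
time.** For an approximate solution `(v, F, π)` on `(0,T]` (`T ≤ 1`, `0 < α ≤ 1`, `ε₀ ≥ 0`) and a
correction `w` in the class `‖w(t)‖ ≤ ρ t^{α-1/2}`, the field `u = ṽ + w` satisfies
`u(t) = e^{(t-s)Δ}u(s) - B¹_s(u,u)(t)` for `0 < s < t ≤ T` (Duhamel formula for `v` from the base
`s`, `Torus.lift_eq_forced_oseenMild`, whose force term `-Σ B¹_s(e_j, F̃_{ij}e_i)` cancels against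
the restarted forcing of `w`; restart law `oseenDuhamel_eq_heatExtension_add_of_envelope` for the
four Duhamel terms of `w`; bilinearity on the window). [cite: CoiculescuPalasek2025, §5 ¶1 (u = v + w solves (1.1)); KochNadirashviliSereginSverak2009, §4 p. 8] -/
theorem IsApproximateSolution.oseenMild_add (h : IsApproximateSolution T α κ K C η ε₀ v F π)
    (hT1 : T ≤ 1) (hα : 0 < α) (hα1 : α ≤ 1 / 2) (hε₀ : 0 ≤ ε₀) {ρ : ℝ} (hρ : 0 ≤ ρ)
    {w : ℝ → ℝ³ → ℝ³} (hw : IsCorrection T α ρ v F w) ⦃s t : ℝ⦄ (hs : 0 < s) (hst : s < t)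
    (htT : t ≤ T) (x : ℝ³) :
    (liftCut T v + w) t x =
      UnboundedOperators.heatExtension ((liftCut T v + w) s) (t - s) x -
        oseenDuhamel 1 s (liftCut T v + w) (liftCut T v + w) t x := by
  -- ### notation and the envelopes
  set V : ℝ → ℝ³ → ℝ³ := liftCut T v with hV
  set ν : ℝ → ℝ := supProfile T v with hν
  set Mw : ℝ → ℝ := fun τ => ρ * τ ^ (α - 1 / 2) with hMw
  set Mf : ℝ → ℝ := fun τ => ε₀ * τ ^ (α - 1) with hMf
  have ht : 0 < t := hs.trans hst
  have hT : 0 < T := ht.trans_le htT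
  have ht1 : t ≤ 1 := htT.trans hT1
  have hα1' : α ≤ 1 := hα1.trans (by norm_num)
  have hsT : s ∈ Ioc 0 T := ⟨hs, hst.le.trans htT⟩
  have htT' : t ∈ Ioc 0 T := ⟨ht, htT⟩
  have hIoo_t : ∀ τ ∈ Ioo 0 t, τ ∈ Ioc 0 T := fun τ hτ => ⟨hτ.1, hτ.2.le.trans htT⟩
  have hIoo_s : ∀ τ ∈ Ioo 0 s, τ ∈ Ioc 0 T := fun τ hτ => ⟨hτ.1, hτ.2.le.trans hsT.2⟩
  have hVm : Measurable (uncurry V) := h.measurable_liftCut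
  have hwm : Measurable (uncurry w) := hw.measurable
  have hem : ∀ p, Measurable (uncurry (unitField p)) := measurable_unitField
  have hfm : ∀ p, Measurable (uncurry (residualField T F p)) := h.measurable_residualField
  have hνm : Measurable ν := h.measurable_supProfile'
  have hMwm : Measurable Mw := measurable_const.mul (measurable_id.pow_const _)
  have hMfm : Measurable Mf := measurable_const.mul (measurable_id.pow_const _)
  have hVb : ∀ τ ∈ Ioo 0 t, ∀ y, ‖V τ y‖ ≤ ν τ := fun τ hτ y => h.norm_liftCut_le (hIoo_t τ hτ) y
  have hwb : ∀ τ ∈ Ioo 0 t, ∀ y, ‖w τ y‖ ≤ Mw τ := fun τ hτ y => hw.norm_le τ (hIoo_t τ hτ) y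
  have heb : ∀ p, ∀ τ ∈ Ioo 0 t, ∀ y, ‖unitField p τ y‖ ≤ (fun _ => (1 : ℝ)) τ :=
    fun p τ _ y => norm_unitField_le p τ y
  have hfb : ∀ p, ∀ τ ∈ Ioo 0 t, ∀ y, ‖residualField T F p τ y‖ ≤ Mf τ :=
    fun p τ hτ y => h.norm_residualField_le hε₀ p (hIoo_t τ hτ) y
  have hν0 : ∀ τ ∈ Ioo 0 t, 0 ≤ ν τ := fun τ _ => supProfile_nonneg' τ
  have hMw0 : ∀ τ ∈ Ioo 0 t, 0 ≤ Mw τ := fun τ hτ => mul_nonneg hρ (Real.rpow_nonneg hτ.1.le _)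
  have hMf0 : ∀ τ ∈ Ioo 0 t, 0 ≤ Mf τ := fun τ hτ => mul_nonneg hε₀ (Real.rpow_nonneg hτ.1.le _)
  have h10 : ∀ τ ∈ Ioo 0 t, (0 : ℝ) ≤ (fun _ => (1 : ℝ)) τ := fun _ _ => zero_le_one
  -- products dominated by `P τ^{α-1}`
  have hνMw : ∀ τ ∈ Ioo 0 t, ν τ * Mw τ ≤ |K 0| * ρ * τ ^ (α - 1) := by
    intro τ hτ
    have h1 := h.supProfile_le (hIoo_t τ hτ)
    have e1 : τ ^ (-(1 / 2 : ℝ)) * τ ^ (α - 1 / 2) = τ ^ (α - 1) := by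
      rw [← Real.rpow_add hτ.1]; congr 1; ring
    calc ν τ * Mw τ ≤ |K 0| * τ ^ (-(1 / 2 : ℝ)) * (ρ * τ ^ (α - 1 / 2)) :=
          mul_le_mul_of_nonneg_right h1 (hMw0 τ hτ)
      _ = |K 0| * ρ * τ ^ (α - 1) := by rw [← e1]; ring
  have hMwν : ∀ τ ∈ Ioo 0 t, Mw τ * ν τ ≤ |K 0| * ρ * τ ^ (α - 1) := fun τ hτ => by
    rw [mul_comm]; exact hνMw τ hτ
  have hMwMw : ∀ τ ∈ Ioo 0 t, Mw τ * Mw τ ≤ ρ ^ 2 * τ ^ (α - 1) := by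
    intro τ hτ
    have hτ1 : τ ≤ 1 := hτ.2.le.trans ht1
    have e1 : τ ^ (α - 1 / 2) * τ ^ (α - 1 / 2) = τ ^ α * τ ^ (α - 1) := by
      rw [← Real.rpow_add hτ.1, ← Real.rpow_add hτ.1]; congr 1; ring
    have h1 : τ ^ α ≤ 1 := Real.rpow_le_one hτ.1.le hτ1 hα.le
    calc Mw τ * Mw τ = ρ ^ 2 * (τ ^ α * τ ^ (α - 1)) := by simp only [hMw]; rw [← e1]; ring
      _ ≤ ρ ^ 2 * (1 * τ ^ (α - 1)) := by
          refine mul_le_mul_of_nonneg_left ?_ (sq_nonneg _)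
          exact mul_le_mul_of_nonneg_right h1 (Real.rpow_nonneg hτ.1.le _)
      _ = ρ ^ 2 * τ ^ (α - 1) := by ring
  have h1Mf : ∀ τ ∈ Ioo 0 t, (fun _ => (1 : ℝ)) τ * Mf τ ≤ ε₀ * τ ^ (α - 1) := fun τ _ => by
    simp only [hMf, one_mul, le_rfl]
  -- envelope integrability on windows `(t₀, t')`, `t' ∈ {s, t}`
  have henv : ∀ {Ma Mb : ℝ → ℝ} {P : ℝ}, Measurable Ma → Measurable Mb →
      (∀ τ ∈ Ioo 0 t, 0 ≤ Ma τ) → (∀ τ ∈ Ioo 0 t, 0 ≤ Mb τ) →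
      (∀ τ ∈ Ioo 0 t, Ma τ * Mb τ ≤ P * τ ^ (α - 1)) → ∀ {t₀ t' : ℝ}, 0 ≤ t₀ → 0 < t' → t' ≤ t →
      IntegrableOn (fun τ => (t' - τ) ^ (-(1 / 2 : ℝ)) * (Ma τ * Mb τ)) (Ioo t₀ t') volume := by
    intro Ma Mb P hMa hMb h0a h0b hP t₀ t' ht₀ ht' ht't
    have hsub : ∀ τ ∈ Ioo 0 t', τ ∈ Ioo 0 t := fun τ hτ => ⟨hτ.1, hτ.2.trans_le ht't⟩
    exact integrableOn_envelope_window ht₀ ht' hα hα1' hMa hMb (fun τ hτ => h0a τ (hsub τ hτ))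
      (fun τ hτ => h0b τ (hsub τ hτ)) (fun τ hτ => hP τ (hsub τ hτ))
  -- ### the restart law for the four kinds of Duhamel terms of `w`
  have hrestart : ∀ {a b : ℝ → ℝ³ → ℝ³} {Ma Mb : ℝ → ℝ} {P : ℝ}, Measurable (uncurry a) →
      Measurable (uncurry b) → (∀ τ ∈ Ioo 0 t, ∀ y, ‖a τ y‖ ≤ Ma τ) →
      (∀ τ ∈ Ioo 0 t, ∀ y, ‖b τ y‖ ≤ Mb τ) → Measurable Ma → Measurable Mb →
      (∀ τ ∈ Ioo 0 t, 0 ≤ Ma τ) → (∀ τ ∈ Ioo 0 t, 0 ≤ Mb τ) →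
      (∀ τ ∈ Ioo 0 t, Ma τ * Mb τ ≤ P * τ ^ (α - 1)) →
      oseenDuhamel 1 0 a b t x =
        UnboundedOperators.heatExtension (oseenDuhamel 1 0 a b s) (t - s) x + oseenDuhamel 1 s a b t x := by
    intro a b Ma Mb P ham hbm ha hb hMa hMb h0a h0b hP
    exact oseenDuhamel_eq_heatExtension_add_of_envelope ham hbm hs hst ha hb
      ((hMa.mul hMb).aestronglyMeasurable)
      (henv hMa hMb h0a h0b hP le_rfl hs hst.le) (henv hMa hMb h0a h0b hP le_rfl ht le_rfl) x
  have hR_Vw := hrestart hVm hwm hVb hwb hνm hMwm hν0 hMw0 hνMw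
  have hR_wV := hrestart hwm hVm hwb hVb hMwm hνm hMw0 hν0 hMwν
  have hR_ww := hrestart hwm hwm hwb hwb hMwm hMwm hMw0 hMw0 hMwMw
  have hR_f : ∀ p, oseenDuhamel 1 0 (unitField p) (residualField T F p) t x =
      UnboundedOperators.heatExtension (oseenDuhamel 1 0 (unitField p) (residualField T F p) s)
        (t - s) x + oseenDuhamel 1 s (unitField p) (residualField T F p) t x := fun p =>
    hrestart (hem p) (hfm p) (heb p) (hfb p) measurable_const hMfm h10 hMf0 h1Mf
  -- ### `e^{(t-s)Δ} w(s)` by linearity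
  have hσ : 0 < t - s := sub_pos.2 hst
  -- the slices at time `s` are bounded and measurable
  have hslice : ∀ {a b : ℝ → ℝ³ → ℝ³} {Ma Mb : ℝ → ℝ} {P : ℝ}, Measurable (uncurry a) →
      Measurable (uncurry b) → (∀ τ ∈ Ioo 0 t, ∀ y, ‖a τ y‖ ≤ Ma τ) →
      (∀ τ ∈ Ioo 0 t, ∀ y, ‖b τ y‖ ≤ Mb τ) → Measurable Ma → Measurable Mb →
      (∀ τ ∈ Ioo 0 t, 0 ≤ Ma τ) → (∀ τ ∈ Ioo 0 t, 0 ≤ Mb τ) →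
      (∀ τ ∈ Ioo 0 t, Ma τ * Mb τ ≤ P * τ ^ (α - 1)) →
      MemLp (oseenDuhamel 1 0 a b s) ∞ (volume : Measure ℝ³) := by
    intro a b Ma Mb P ham hbm ha hb hMa hMb h0a h0b hP
    have hsub : ∀ τ ∈ Ioo 0 s, τ ∈ Ioo 0 t := fun τ hτ => ⟨hτ.1, hτ.2.trans hst⟩
    refine memLp_top_of_measurable_bound
      ((measurable_uncurry_oseenDuhamel_from ham hbm 1 0).comp (measurable_const.prodMk measurable_id))
      (M := oseenSliceConst ℝ³ * ∫ τ in Ioo 0 s, (s - τ) ^ (-(1 / 2 : ℝ)) * (Ma τ * Mb τ)) ?_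
    intro y
    exact norm_oseenDuhamel_le_setIntegral (fun τ hτ z => ha τ (hsub τ hτ) z)
      (fun τ hτ z => hb τ (hsub τ hτ) z) (henv hMa hMb h0a h0b hP le_rfl hs hst.le) y
  have hL_Vw := hslice hVm hwm hVb hwb hνm hMwm hν0 hMw0 hνMw
  have hL_wV := hslice hwm hVm hwb hVb hMwm hνm hMw0 hν0 hMwν
  have hL_ww := hslice hwm hwm hwb hwb hMwm hMwm hMw0 hMw0 hMwMw
  have hL_f : ∀ p, MemLp (oseenDuhamel 1 0 (unitField p) (residualField T F p) s) ∞
      (volume : Measure ℝ³) := fun p =>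
    hslice (hem p) (hfm p) (heb p) (hfb p) measurable_const hMfm h10 hMf0 h1Mf
  have hL_forcing : MemLp (forcing T F s) ∞ (volume : Measure ℝ³) := by
    have e : forcing T F s = fun z => ∑ p : Fin 3 × Fin 3,
        oseenDuhamel 1 0 (unitField p) (residualField T F p) s z := by
      funext z; simp only [forcing]
    rw [e]; exact memLp_finsetSum _ fun p _ => hL_f p
  -- the identity for the slice `w(s)`
  have hws : w s = forcing T F s + (-(oseenDuhamel 1 0 V w s) + (-(oseenDuhamel 1 0 w V s) +
      -(oseenDuhamel 1 0 w w s))) := by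
    funext z
    simp only [Pi.add_apply, Pi.neg_apply]
    rw [hw.eq s hsT z, ← hV]; abel
  have hHw : UnboundedOperators.heatExtension (w s) (t - s) x =
      (∑ p : Fin 3 × Fin 3, UnboundedOperators.heatExtension
        (oseenDuhamel 1 0 (unitField p) (residualField T F p) s) (t - s) x) -
      UnboundedOperators.heatExtension (oseenDuhamel 1 0 V w s) (t - s) x -
      UnboundedOperators.heatExtension (oseenDuhamel 1 0 w V s) (t - s) x -
      UnboundedOperators.heatExtension (oseenDuhamel 1 0 w w s) (t - s) x := by
    rw [hws, heatExtension_add_of_memLp_top hL_forcing (hL_Vw.neg.add (hL_wV.neg.add hL_ww.neg)) hσ,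
      heatExtension_add_of_memLp_top hL_Vw.neg (hL_wV.neg.add hL_ww.neg) hσ,
      heatExtension_add_of_memLp_top hL_wV.neg hL_ww.neg hσ,
      heatExtension_neg_of_memLp_top hL_Vw hσ, heatExtension_neg_of_memLp_top hL_wV hσ,
      heatExtension_neg_of_memLp_top hL_ww hσ]
    have e : forcing T F s = fun z => ∑ p : Fin 3 × Fin 3,
        oseenDuhamel 1 0 (unitField p) (residualField T F p) s z := by
      funext z; simp only [forcing]
    rw [e, heatExtension_sum_of_memLp_top _ (fun p _ => hL_f p) hσ]
    abel
  -- ### the identity for `w(t)`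
  have hwt : w t x = UnboundedOperators.heatExtension (w s) (t - s) x +
      (∑ p : Fin 3 × Fin 3, oseenDuhamel 1 s (unitField p) (residualField T F p) t x) -
      oseenDuhamel 1 s V w t x - oseenDuhamel 1 s w V t x - oseenDuhamel 1 s w w t x := by
    rw [hw.eq t htT' x, ← hV, hHw]
    simp only [forcing, hR_Vw, hR_wV, hR_ww]
    rw [Finset.sum_congr rfl fun p _ => hR_f p, Finset.sum_add_distrib]
    abel
  -- ### the identity for `ṽ(t)` (Duhamel formula from the base `s`)
  have hmean : ∫ y, v t y = ∫ y, v s y := by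
    rw [show (∫ y, v t y) = 0 from h.hasZeroMean t htT', show (∫ y, v s y) = 0 from h.hasZeroMean s hsT]
  have hVt := Torus.lift_eq_forced_oseenMild (d := Fin 3) h.solution h.smooth_residual
    (uniqueDiffOn_Ioc 0 T) hst (fun τ hτ => ⟨hs.trans_le hτ.1, hτ.2.trans htT⟩) hmean x
  -- rewrite its fields through `V` and the cut-off residual fields on the window `(s, t)`
  have hwin : ∀ τ ∈ Ioo s t, τ ∈ Ioc 0 T := fun τ hτ => ⟨hs.trans hτ.1, hτ.2.le.trans htT⟩
  have hVV : oseenDuhamel 1 s (fun τ => Torus.lift (v τ)) (fun τ => Torus.lift (v τ)) t x =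
      oseenDuhamel 1 s V V t x :=
    oseenDuhamel_congr_of_eqOn_Ioo (fun τ hτ => (liftCut_of_mem (hwin τ hτ)).symm)
      (fun τ hτ => (liftCut_of_mem (hwin τ hτ)).symm) x
  have hVf : ∀ p : Fin 3 × Fin 3, oseenDuhamel 1 s (fun _ _ => EuclideanSpace.single p.2 (1 : ℝ))
      (fun τ z => F τ (Torus.proj z) p.1 p.2 • EuclideanSpace.single p.1 (1 : ℝ)) t x =
      oseenDuhamel 1 s (unitField p) (residualField T F p) t x := fun p =>
    oseenDuhamel_congr_of_eqOn_Ioo (fun τ _ => rfl)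
      (fun τ hτ => (residualField_of_mem p (hwin τ hτ)).symm) x
  have hVt' : V t x = UnboundedOperators.heatExtension (V s) (t - s) x - oseenDuhamel 1 s V V t x -
      ∑ p : Fin 3 × Fin 3, oseenDuhamel 1 s (unitField p) (residualField T F p) t x := by
    have e1 : V t x = Torus.lift (v t) x := by rw [hV, liftCut_of_mem htT']
    have e2 : V s = Torus.lift (v s) := by rw [hV, liftCut_of_mem hsT]
    rw [e1, e2, hVt, hVV]
    simp only [hVf]
  -- ### bilinearity on the window `(s, t)` with constant envelopes
  set Cv : ℝ := |K 0| * s ^ (-(1 / 2 : ℝ)) with hCv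
  set Cw : ℝ := ρ * s ^ (α - 1 / 2) with hCw
  have hVc : ∀ τ ∈ Ioo s t, ∀ y, ‖V τ y‖ ≤ (fun _ => Cv) τ := by
    intro τ hτ y
    refine (hVb τ ⟨hs.trans hτ.1, hτ.2⟩ y).trans ((h.supProfile_le (hwin τ hτ)).trans ?_)
    exact mul_le_mul_of_nonneg_left (Real.rpow_le_rpow_of_nonpos hs hτ.1.le (by norm_num)) (abs_nonneg _)
  have hwc : ∀ τ ∈ Ioo s t, ∀ y, ‖w τ y‖ ≤ (fun _ => Cw) τ := by
    intro τ hτ y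
    refine (hwb τ ⟨hs.trans hτ.1, hτ.2⟩ y).trans ?_
    exact mul_le_mul_of_nonneg_left (Real.rpow_le_rpow_of_nonpos hs hτ.1.le (by linarith)) hρ
  have hwin_env : ∀ c : ℝ, IntegrableOn (fun τ => (t - τ) ^ (-(1 / 2 : ℝ)) * c) (Ioo s t) volume :=
    fun c => (integrableOn_sub_rpow_Ioo (by norm_num)).mul_const c
  have hcc : ∀ a b : ℝ, IntegrableOn (fun τ => (t - τ) ^ (-(1 / 2 : ℝ)) *
      ((fun _ : ℝ => a) τ * (fun _ : ℝ => b) τ)) (Ioo s t) volume := fun a b => hwin_env (a * b)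
  have hBuu : oseenDuhamel 1 s (V + w) (V + w) t x =
      oseenDuhamel 1 s V V t x + oseenDuhamel 1 s V w t x + oseenDuhamel 1 s w V t x +
        oseenDuhamel 1 s w w t x := by
    have hVwm : Measurable (uncurry (V + w)) := hVm.add hwm
    have hVwc : ∀ τ ∈ Ioo s t, ∀ y, ‖(V + w) τ y‖ ≤ (fun _ => Cv + Cw) τ := fun τ hτ y =>
      (norm_add_le _ _).trans (add_le_add (hVc τ hτ y) (hwc τ hτ y))
    rw [oseenDuhamel_add_left_of_envelope hVm hwm hVwm hVc hwc hVwc (hcc _ _) (hcc _ _) x,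
      oseenDuhamel_add_right_of_envelope hVm hVm hwm hVc hVc hwc (hcc _ _) (hcc _ _) x,
      oseenDuhamel_add_right_of_envelope hwm hVm hwm hwc hVc hwc (hcc _ _) (hcc _ _) x]
    abel
  -- ### `e^{(t-s)Δ} u(s)` by linearity
  have hHu : UnboundedOperators.heatExtension ((V + w) s) (t - s) x =
      UnboundedOperators.heatExtension (V s) (t - s) x +
        UnboundedOperators.heatExtension (w s) (t - s) x := by
    have hVs : MemLp (V s) ∞ (volume : Measure ℝ³) :=
      memLp_top_of_measurable_bound (hVm.comp (measurable_const.prodMk measurable_id))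
        (fun y => h.norm_liftCut_le hsT y)
    have hwsL : MemLp (w s) ∞ (volume : Measure ℝ³) :=
      memLp_top_of_measurable_bound (hwm.comp (measurable_const.prodMk measurable_id))
        (fun y => hw.norm_le s hsT y)
    exact heatExtension_add_of_memLp_top hVs hwsL hσ x
  -- ### assembling
  rw [hBuu, hHu, Pi.add_apply, Pi.add_apply, hVt', hwt]
  abel

end Mild

/-! ## Duhamel terms of pairs under power envelopes -/

section Pairs

/-- **A pair of fields under positive power envelopes on `(0,T]`**: `a, b` jointly measurable
with `‖a(τ)‖_∞ ≤ M_a(τ)`, `‖b(τ)‖_∞ ≤ M_b(τ)` on `(0,T]`, the envelopes measurable, continuous and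
positive on `(0,∞)`, and `M_a M_b ≤ P τ^{α-1}` on `(0,T]` (the pairs `(ṽ,w)`, `(w,ṽ)`, `(w,w)`,
`(e_j, F̃_{ij}e_i)` of the perturbation equation, with `M ∈ {(|K₀|+1)τ^{-1/2}, (ρ+1)τ^{α-1/2}, 1,
(ε₀+1)τ^{α-1}}`). [cite: CoiculescuPalasek2025, Prop. 3.13 (3.13a), Prop. 4.1, Prop. 4.3] -/
structure IsEnvelopePair (T α : ℝ) (a b : ℝ → ℝ³ → ℝ³) (Ma Mb : ℝ → ℝ) (P : ℝ) : Prop where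
  /-- Joint measurability of `a`. -/
  measurable_left : Measurable (uncurry a)
  /-- Joint measurability of `b`. -/
  measurable_right : Measurable (uncurry b)
  /-- The envelope of `a`. -/
  norm_left_le : ∀ τ ∈ Ioc 0 T, ∀ y, ‖a τ y‖ ≤ Ma τ
  /-- The envelope of `b`. -/
  norm_right_le : ∀ τ ∈ Ioc 0 T, ∀ y, ‖b τ y‖ ≤ Mb τ
  /-- Measurability of `M_a`. -/
  measurable_envLeft : Measurable Ma
  /-- Measurability of `M_b`. -/
  measurable_envRight : Measurable Mb
  /-- Continuity of `M_a` on `(0,∞)`. -/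
  continuousOn_envLeft : ContinuousOn Ma (Ioi 0)
  /-- Continuity of `M_b` on `(0,∞)`. -/
  continuousOn_envRight : ContinuousOn Mb (Ioi 0)
  /-- Positivity of `M_a`. -/
  envLeft_pos : ∀ τ, 0 < τ → 0 < Ma τ
  /-- Positivity of `M_b`. -/
  envRight_pos : ∀ τ, 0 < τ → 0 < Mb τ
  /-- `0 ≤ P`. -/
  const_nonneg : 0 ≤ P
  /-- The product profile `M_a M_b ≤ P τ^{α-1}` on `(0,T]`. -/
  mul_le : ∀ τ ∈ Ioc 0 T, Ma τ * Mb τ ≤ P * τ ^ (α - 1)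

namespace IsEnvelopePair

variable {T α : ℝ} {a b : ℝ → ℝ³ → ℝ³} {Ma Mb : ℝ → ℝ} {P : ℝ}

/-- Envelope integrability `(t-τ)^{-1/2} M_a M_b ∈ L¹(t₀, t)` for `t ∈ (0,T]`, `0 ≤ t₀`. [folklore] -/
theorem integrableOn (hp : IsEnvelopePair T α a b Ma Mb P) (hα : 0 < α) (hα1 : α ≤ 1) {t₀ t : ℝ}
    (ht₀ : 0 ≤ t₀) (ht : t ∈ Ioc 0 T) :
    IntegrableOn (fun τ => (t - τ) ^ (-(1 / 2 : ℝ)) * (Ma τ * Mb τ)) (Ioo t₀ t) volume :=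
  integrableOn_envelope_window ht₀ ht.1 hα hα1 hp.measurable_envLeft hp.measurable_envRight
    (fun τ hτ => (hp.envLeft_pos τ hτ.1).le) (fun τ hτ => (hp.envRight_pos τ hτ.1).le)
    (fun τ hτ => hp.mul_le τ ⟨hτ.1, hτ.2.le.trans ht.2⟩)

/-- The product envelope is integrable on `(0,t)` with `∫₀ᵗ M_aM_b ≤ P t^α/α`. [folklore] -/
theorem integrableOn_mul (hp : IsEnvelopePair T α a b Ma Mb P) (hα : 0 < α) {t : ℝ}
    (ht : t ∈ Ioc 0 T) :
    IntegrableOn (fun τ => Ma τ * Mb τ) (Ioo 0 t) volume ∧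
      ∫ τ in Ioo 0 t, Ma τ * Mb τ ≤ P * (t ^ α / α) := by
  have hint : IntegrableOn (fun τ : ℝ => τ ^ (α - 1)) (Ioo 0 t) volume := by
    rw [← intervalIntegrable_iff_integrableOn_Ioo_of_le ht.1.le]
    exact intervalIntegral.intervalIntegrable_rpow' (by linarith)
  have hval : ∫ τ in Ioo 0 t, τ ^ (α - 1) = t ^ α / α := by
    rw [← integral_Ioc_eq_integral_Ioo, ← intervalIntegral.integral_of_le ht.1.le,
      integral_rpow (Or.inl (by linarith))]
    rw [show α - 1 + 1 = α by ring, Real.zero_rpow hα.ne', sub_zero]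
  have hmeas : AEStronglyMeasurable (fun τ => Ma τ * Mb τ) (volume.restrict (Ioo 0 t)) :=
    (hp.measurable_envLeft.mul hp.measurable_envRight).aestronglyMeasurable
  have hdom : ∀ τ ∈ Ioo 0 t, ‖Ma τ * Mb τ‖ ≤ P * τ ^ (α - 1) := fun τ hτ => by
    rw [Real.norm_eq_abs, abs_of_nonneg (mul_nonneg (hp.envLeft_pos τ hτ.1).le (hp.envRight_pos τ hτ.1).le)]
    exact hp.mul_le τ ⟨hτ.1, hτ.2.le.trans ht.2⟩
  have hi : IntegrableOn (fun τ => Ma τ * Mb τ) (Ioo 0 t) volume :=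
    Integrable.mono' (hint.const_mul P) hmeas ((ae_restrict_iff' measurableSet_Ioo).2
      (Eventually.of_forall hdom))
  refine ⟨hi, ?_⟩
  calc ∫ τ in Ioo 0 t, Ma τ * Mb τ ≤ ∫ τ in Ioo 0 t, P * τ ^ (α - 1) :=
        setIntegral_mono_on hi (hint.const_mul P) measurableSet_Ioo fun τ hτ =>
          (le_abs_self _).trans ((Real.norm_eq_abs _).symm.le.trans (hdom τ hτ))
    _ = P * (t ^ α / α) := by rw [integral_const_mul, hval]

/-- **Sup bound of the Duhamel term**: `‖B¹₀(a,b)(t)(y)‖ ≤ C₀ P (2/α+4) t^{α-1/2}`. [cite: CoiculescuPalasek2025, proof of Prop. 4.2 (‖II‖, ‖III‖)] -/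
theorem norm_oseenDuhamel_le (hp : IsEnvelopePair T α a b Ma Mb P) (hα : 0 < α) (hα1 : α ≤ 1) {t : ℝ}
    (ht : t ∈ Ioc 0 T) (y : ℝ³) :
    ‖oseenDuhamel 1 0 a b t y‖ ≤ oseenSliceConst ℝ³ * (P * ((2 / α + 4) * t ^ (α - 1 / 2))) := by
  have hsub : ∀ τ ∈ Ioo 0 t, τ ∈ Ioc 0 T := fun τ hτ => ⟨hτ.1, hτ.2.le.trans ht.2⟩
  refine (norm_oseenDuhamel_le_setIntegral (fun τ hτ z => hp.norm_left_le τ (hsub τ hτ) z)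
    (fun τ hτ z => hp.norm_right_le τ (hsub τ hτ) z) (hp.integrableOn hα hα1 le_rfl ht) y).trans ?_
  refine mul_le_mul_of_nonneg_left ?_ (oseenSliceConst_pos (E := ℝ³)).le
  obtain ⟨hint, hle⟩ := integrableOn_forcing_envelope (t₀ := 0) (ε₀ := P) le_rfl ht.1 hα hα1
  rw [abs_of_nonneg hp.const_nonneg] at hle
  refine le_trans (setIntegral_mono_on (hp.integrableOn hα hα1 le_rfl ht) hint measurableSet_Ioo
    fun τ hτ => ?_) hle
  rw [one_mul]
  exact mul_le_mul_of_nonneg_left (hp.mul_le τ (hsub τ hτ)) (Real.rpow_nonneg (by linarith [hτ.2]) _)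

/-- The slices of the Duhamel term are measurable. [folklore] -/
theorem measurable_oseenDuhamel (hp : IsEnvelopePair T α a b Ma Mb P) (t : ℝ) :
    Measurable (oseenDuhamel 1 0 a b t) :=
  (measurable_uncurry_oseenDuhamel_from hp.measurable_left hp.measurable_right 1 0).comp
    (measurable_const.prodMk measurable_id)

/-- The slices of the Duhamel term are in `L^∞`. [folklore] -/
theorem memLp_oseenDuhamel (hp : IsEnvelopePair T α a b Ma Mb P) (hα : 0 < α) (hα1 : α ≤ 1) {t : ℝ}
    (ht : t ∈ Ioc 0 T) : MemLp (oseenDuhamel 1 0 a b t) ∞ (volume : Measure ℝ³) :=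
  memLp_top_of_measurable_bound (hp.measurable_oseenDuhamel t) (hp.norm_oseenDuhamel_le hα hα1 ht)

/-- **The Duhamel term is weakly divergence free** (`isWeaklyDivFree_oseenDuhamel_of_envelope`).
[cite: KochNadirashviliSereginSverak2009, §3 p. 6] -/
theorem isWeaklyDivFree (hp : IsEnvelopePair T α a b Ma Mb P) (hα : 0 < α) (hα1 : α ≤ 1) {t : ℝ}
    (ht : t ∈ Ioc 0 T) : IsWeaklyDivFree (oseenDuhamel 1 0 a b t) := by
  have hsub : ∀ τ ∈ Ioo 0 t, τ ∈ Ioc 0 T := fun τ hτ => ⟨hτ.1, hτ.2.le.trans ht.2⟩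
  exact isWeaklyDivFree_oseenDuhamel_of_envelope hp.measurable_left hp.measurable_right ht.1
    (fun τ hτ z => hp.norm_left_le τ (hsub τ hτ) z) (fun τ hτ z => hp.norm_right_le τ (hsub τ hτ) z)
    (hp.continuousOn_envLeft.mono fun τ hτ => hτ.1) (hp.continuousOn_envRight.mono fun τ hτ => hτ.1)
    (hp.integrableOn hα hα1 le_rfl ht)

/-- The descended Duhamel term is integrable on `𝕋³`. [folklore] -/
theorem integrable_repr (hp : IsEnvelopePair T α a b Ma Mb P) (hα : 0 < α) (hα1 : α ≤ 1) {t : ℝ}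
    (ht : t ∈ Ioc 0 T) :
    Integrable (fun x : 𝕋³ => oseenDuhamel 1 0 a b t (Torus.repr x)) volume := by
  have hm : Measurable fun x : 𝕋³ => oseenDuhamel 1 0 a b t (Torus.repr x) :=
    (hp.measurable_oseenDuhamel t).comp Torus.measurable_repr
  exact (integrable_const _).mono' hm.aestronglyMeasurable
    (Eventually.of_forall fun x => hp.norm_oseenDuhamel_le hα hα1 ht _)

/-- **Zero mean of the descended Duhamel term** when the slices are lifts of continuous torus
fields (`Torus.integral_oseenDuhamel_repr_eq_zero_of_envelope`). [cite: CoiculescuPalasek2025, §5 (u⁽ⁱ⁾ mean zero)] -/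
theorem integral_repr_eq_zero (hp : IsEnvelopePair T α a b Ma Mb P) (hα : 0 < α) (hα1 : α ≤ 1) {t : ℝ}
    (ht : t ∈ Ioc 0 T) {A B : ℝ → 𝕋³ → ℝ³} (hA : ∀ τ ∈ Ioc 0 T, Continuous (A τ))
    (hB : ∀ τ ∈ Ioc 0 T, Continuous (B τ)) (hla : ∀ τ ∈ Ioc 0 T, Torus.lift (A τ) = a τ)
    (hlb : ∀ τ ∈ Ioc 0 T, Torus.lift (B τ) = b τ) :
    ∫ x : 𝕋³, oseenDuhamel 1 0 a b t (Torus.repr x) = 0 := by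
  have hsub : ∀ τ ∈ Ioo 0 t, τ ∈ Ioc 0 T := fun τ hτ => ⟨hτ.1, hτ.2.le.trans ht.2⟩
  exact Torus.integral_oseenDuhamel_repr_eq_zero_of_envelope hp.measurable_left hp.measurable_right
    (fun τ hτ z => hp.norm_left_le τ (hsub τ hτ) z) (fun τ hτ z => hp.norm_right_le τ (hsub τ hτ) z)
    (hp.integrableOn hα hα1 le_rfl ht) (fun τ hτ => hA τ (hsub τ hτ)) (fun τ hτ => hB τ (hsub τ hτ))
    (fun τ hτ => hla τ (hsub τ hτ)) (fun τ hτ => hlb τ (hsub τ hτ))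

/-- **`Ḣ⁻¹` bound of the descended Duhamel term**: `‖B¹₀(a,b)(t)∘repr‖_{Ḣ⁻¹} ≤ 2π·27·P t^α/α`
(`Torus.eHomSobolevSeminorm_neg_one_oseenDuhamel_repr_le`). [cite: CoiculescuPalasek2025, proof of Prop. 4.3 (w(t) → 0)] -/
theorem eHomSobolevSeminorm_repr_le (hp : IsEnvelopePair T α a b Ma Mb P) (hα : 0 < α) (hα1 : α ≤ 1)
    {t : ℝ} (ht : t ∈ Ioc 0 T) {A B : ℝ → 𝕋³ → ℝ³} (hA : ∀ τ ∈ Ioc 0 T, Continuous (A τ))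
    (hB : ∀ τ ∈ Ioc 0 T, Continuous (B τ)) (hla : ∀ τ ∈ Ioc 0 T, Torus.lift (A τ) = a τ)
    (hlb : ∀ τ ∈ Ioc 0 T, Torus.lift (B τ) = b τ) :
    Torus.eHomSobolevSeminorm (-1) (EuclideanSpace.complexify ∘ fun x : 𝕋³ =>
        oseenDuhamel 1 0 a b t (Torus.repr x)) ≤
      ENNReal.ofReal (2 * Real.pi * 27 * (P * (t ^ α / α))) := by
  have hsub : ∀ τ ∈ Ioo 0 t, τ ∈ Ioc 0 T := fun τ hτ => ⟨hτ.1, hτ.2.le.trans ht.2⟩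
  obtain ⟨hρ, hle⟩ := hp.integrableOn_mul hα ht
  refine (Torus.eHomSobolevSeminorm_neg_one_oseenDuhamel_repr_le hp.measurable_left hp.measurable_right
    (fun τ hτ z => hp.norm_left_le τ (hsub τ hτ) z) (fun τ hτ z => hp.norm_right_le τ (hsub τ hτ) z)
    (fun τ hτ => mul_pos (hp.envLeft_pos τ hτ.1) (hp.envRight_pos τ hτ.1))
    (hp.integrableOn hα hα1 le_rfl ht) hρ (fun τ hτ => hA τ (hsub τ hτ)) (fun τ hτ => hB τ (hsub τ hτ))
    (fun τ hτ => hla τ (hsub τ hτ)) (fun τ hτ => hlb τ (hsub τ hτ))).trans ?_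
  refine ENNReal.ofReal_le_ofReal ?_
  have h3 : ((Fintype.card (Fin 3) : ℝ)) ^ 3 = 27 := by norm_num
  rw [h3]
  exact mul_le_mul_of_nonneg_left hle (by positivity)

end IsEnvelopePair

end Pairs

/-! ## The four pairs of the perturbation equation -/

section FourPairs

variable {T α : ℝ} {κ : ℝ≥0} {K : ℕ → ℝ} {C η ε₀ : ℝ}
  {v : ℝ → 𝕋³ → ℝ³} {F : ℝ → 𝕋³ → (Fin 3 → Fin 3 → ℝ)} {π : ℝ → 𝕋³ → ℝ}
  {ρ : ℝ} {w : ℝ → ℝ³ → ℝ³}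

/-- Power envelopes `c τ^e` with `c > 0` are measurable, continuous and positive on `(0,∞)`.
[folklore] -/
theorem powEnvelope_props {c e : ℝ} (hc : 0 < c) :
    Measurable (fun τ : ℝ => c * τ ^ e) ∧ ContinuousOn (fun τ : ℝ => c * τ ^ e) (Ioi 0) ∧
      ∀ τ : ℝ, 0 < τ → 0 < c * τ ^ e :=
  ⟨measurable_const.mul (measurable_id.pow_const _),
    continuousOn_const.mul (continuousOn_id.rpow_const fun _ hτ => Or.inl (ne_of_gt hτ)),
    fun _ hτ => mul_pos hc (Real.rpow_pos_of_pos hτ _)⟩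

/-- **The pair `(ṽ, w)`** with envelopes `(|K₀|+1)τ^{-1/2}`, `(ρ+1)τ^{α-1/2}`.
[cite: CoiculescuPalasek2025, Prop. 3.13 (3.13a) and Prop. 4.3] -/
theorem IsApproximateSolution.isEnvelopePair_vw (h : IsApproximateSolution T α κ K C η ε₀ v F π)
    (hρ : 0 ≤ ρ) (hw : IsCorrection T α ρ v F w) :
    IsEnvelopePair T α (liftCut T v) w (fun τ => (|K 0| + 1) * τ ^ (-(1 / 2 : ℝ)))
      (fun τ => (ρ + 1) * τ ^ (α - 1 / 2)) ((|K 0| + 1) * (ρ + 1)) := by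
  obtain ⟨hm1, hc1, hp1⟩ := powEnvelope_props (e := -(1 / 2 : ℝ)) (c := |K 0| + 1) (by positivity)
  obtain ⟨hm2, hc2, hp2⟩ := powEnvelope_props (e := α - 1 / 2) (c := ρ + 1) (by linarith)
  refine ⟨h.measurable_liftCut, hw.measurable, fun τ hτ y => ?_, fun τ hτ y => ?_, hm1, hm2, hc1, hc2,
    hp1, hp2, by positivity, fun τ hτ => le_of_eq ?_⟩
  · refine (h.norm_liftCut_le hτ y).trans ((h.supProfile_le hτ).trans ?_)
    exact mul_le_mul_of_nonneg_right (by linarith) (Real.rpow_nonneg hτ.1.le _)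
  · exact (hw.norm_le τ hτ y).trans (mul_le_mul_of_nonneg_right (by linarith) (Real.rpow_nonneg hτ.1.le _))
  · have e1 : τ ^ (-(1 / 2 : ℝ)) * τ ^ (α - 1 / 2) = τ ^ (α - 1) := by
      rw [← Real.rpow_add hτ.1]; congr 1; ring
    calc (|K 0| + 1) * τ ^ (-(1 / 2 : ℝ)) * ((ρ + 1) * τ ^ (α - 1 / 2))
        = (|K 0| + 1) * (ρ + 1) * (τ ^ (-(1 / 2 : ℝ)) * τ ^ (α - 1 / 2)) := by ring
      _ = (|K 0| + 1) * (ρ + 1) * τ ^ (α - 1) := by rw [e1]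

/-- **The pair `(w, ṽ)`.** [cite: CoiculescuPalasek2025, Prop. 3.13 (3.13a) and Prop. 4.3] -/
theorem IsApproximateSolution.isEnvelopePair_wv (h : IsApproximateSolution T α κ K C η ε₀ v F π)
    (hρ : 0 ≤ ρ) (hw : IsCorrection T α ρ v F w) :
    IsEnvelopePair T α w (liftCut T v) (fun τ => (ρ + 1) * τ ^ (α - 1 / 2))
      (fun τ => (|K 0| + 1) * τ ^ (-(1 / 2 : ℝ))) ((|K 0| + 1) * (ρ + 1)) := by
  have hp := h.isEnvelopePair_vw hρ hw
  exact ⟨hp.measurable_right, hp.measurable_left, hp.norm_right_le, hp.norm_left_le,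
    hp.measurable_envRight, hp.measurable_envLeft, hp.continuousOn_envRight, hp.continuousOn_envLeft,
    hp.envRight_pos, hp.envLeft_pos, hp.const_nonneg, fun τ hτ => by rw [mul_comm]; exact hp.mul_le τ hτ⟩

/-- **The pair `(w, w)`** (`τ^{2α-1} ≤ τ^{α-1}` on `(0,1]`). [cite: CoiculescuPalasek2025, Prop. 4.3] -/
theorem IsApproximateSolution.isEnvelopePair_ww (hT1 : T ≤ 1) (hα : 0 < α) (hρ : 0 ≤ ρ)
    (hw : IsCorrection T α ρ v F w) :
    IsEnvelopePair T α w w (fun τ => (ρ + 1) * τ ^ (α - 1 / 2)) (fun τ => (ρ + 1) * τ ^ (α - 1 / 2))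
      ((ρ + 1) ^ 2) := by
  obtain ⟨hm2, hc2, hp2⟩ := powEnvelope_props (e := α - 1 / 2) (c := ρ + 1) (by linarith)
  have hb : ∀ τ ∈ Ioc 0 T, ∀ y, ‖w τ y‖ ≤ (ρ + 1) * τ ^ (α - 1 / 2) := fun τ hτ y =>
    (hw.norm_le τ hτ y).trans (mul_le_mul_of_nonneg_right (by linarith) (Real.rpow_nonneg hτ.1.le _))
  refine ⟨hw.measurable, hw.measurable, hb, hb, hm2, hm2, hc2, hc2, hp2, hp2, by positivity, fun τ hτ => ?_⟩
  have hτ1 : τ ≤ 1 := hτ.2.trans hT1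
  have e1 : τ ^ (α - 1 / 2) * τ ^ (α - 1 / 2) = τ ^ α * τ ^ (α - 1) := by
    rw [← Real.rpow_add hτ.1, ← Real.rpow_add hτ.1]; congr 1; ring
  have h1 : τ ^ α ≤ 1 := Real.rpow_le_one hτ.1.le hτ1 hα.le
  calc (ρ + 1) * τ ^ (α - 1 / 2) * ((ρ + 1) * τ ^ (α - 1 / 2))
      = (ρ + 1) ^ 2 * (τ ^ α * τ ^ (α - 1)) := by rw [← e1]; ring
    _ ≤ (ρ + 1) ^ 2 * (1 * τ ^ (α - 1)) := by
        refine mul_le_mul_of_nonneg_left ?_ (sq_nonneg _)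
        exact mul_le_mul_of_nonneg_right h1 (Real.rpow_nonneg hτ.1.le _)
    _ = (ρ + 1) ^ 2 * τ ^ (α - 1) := by ring

/-- **The forcing pairs `(e_j, F̃_{ij} e_i)`** with envelopes `1`, `(ε₀+1)τ^{α-1}`.
[cite: CoiculescuPalasek2025, Prop. 4.1] -/
theorem IsApproximateSolution.isEnvelopePair_forcing (h : IsApproximateSolution T α κ K C η ε₀ v F π)
    (hε₀ : 0 ≤ ε₀) (p : Fin 3 × Fin 3) :
    IsEnvelopePair T α (unitField p) (residualField T F p) (fun _ => (1 : ℝ))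
      (fun τ => (ε₀ + 1) * τ ^ (α - 1)) (ε₀ + 1) := by
  obtain ⟨hm2, hc2, hp2⟩ := powEnvelope_props (e := α - 1) (c := ε₀ + 1) (by linarith)
  refine ⟨measurable_unitField p, h.measurable_residualField p, fun τ _ y => norm_unitField_le p τ y,
    fun τ hτ y => ?_, measurable_const, hm2, continuousOn_const, hc2, fun _ _ => one_pos, hp2,
    by linarith, fun τ _ => le_of_eq (one_mul _)⟩
  exact (h.norm_residualField_le hε₀ p hτ y).trans
    (mul_le_mul_of_nonneg_right (by linarith) (Real.rpow_nonneg hτ.1.le _))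

/-! ### Consequences for the correction -/

/-- **Weak divergence-freeness of finite sums** of bounded measurable weakly divergence-free
fields. [folklore] -/
theorem isWeaklyDivFree_sum_of_bound {ι : Type*} (s : Finset ι) {f : ι → ℝ³ → ℝ³}
    (hdf : ∀ i ∈ s, IsWeaklyDivFree (f i)) (hm : ∀ i ∈ s, Measurable (f i)) {M : ι → ℝ}
    (hb : ∀ i ∈ s, ∀ y, ‖f i y‖ ≤ M i) :
    IsWeaklyDivFree (fun y => ∑ i ∈ s, f i y) := by
  classical
  induction s using Finset.induction_on with
  | empty =>
    intro θ hθ; simp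
  | insert a s ha ih =>
    have e : (fun y => ∑ i ∈ insert a s, f i y) = f a + fun y => ∑ i ∈ s, f i y := by
      funext y; simp [Finset.sum_insert ha]
    rw [e]
    have hs_df := ih (fun i hi => hdf i (Finset.mem_insert_of_mem hi))
      (fun i hi => hm i (Finset.mem_insert_of_mem hi)) (fun i hi => hb i (Finset.mem_insert_of_mem hi))
    refine isWeaklyDivFree_add_of_bound (hdf a (Finset.mem_insert_self a s)) hs_df
      (hm a (Finset.mem_insert_self a s)).aestronglyMeasurable
      (Finset.measurable_sum s fun i hi => hm i (Finset.mem_insert_of_mem hi)).aestronglyMeasurable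
      (hb a (Finset.mem_insert_self a s)) (M₂ := ∑ i ∈ s, M i) fun y => ?_
    exact norm_sum_le_of_le _ fun i hi => hb i (Finset.mem_insert_of_mem hi) y

/-- **The slices of the correction are weakly divergence free** (each Duhamel term is).
[cite: CoiculescuPalasek2025, §5 ¶1; KochNadirashviliSereginSverak2009, §3 p. 6] -/
theorem IsApproximateSolution.isWeaklyDivFree_correction (h : IsApproximateSolution T α κ K C η ε₀ v F π)
    (hT1 : T ≤ 1) (hα : 0 < α) (hα1 : α ≤ 1) (hε₀ : 0 ≤ ε₀) (hρ : 0 ≤ ρ) (hw : IsCorrection T α ρ v F w)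
    {t : ℝ} (ht : t ∈ Ioc 0 T) : IsWeaklyDivFree (w t) := by
  have hpVw := h.isEnvelopePair_vw hρ hw
  have hpwV := h.isEnvelopePair_wv hρ hw
  have hpww := IsApproximateSolution.isEnvelopePair_ww (v := v) (F := F) hT1 hα hρ hw
  have hpf := fun p => h.isEnvelopePair_forcing hε₀ p
  set V := liftCut T v with hV
  have hwt : w t = (fun y => ∑ p : Fin 3 × Fin 3, oseenDuhamel 1 0 (unitField p) (residualField T F p) t y) +
      (-(oseenDuhamel 1 0 V w t) + (-(oseenDuhamel 1 0 w V t) + -(oseenDuhamel 1 0 w w t))) := by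
    funext z
    simp only [Pi.add_apply, Pi.neg_apply]
    rw [hw.eq t ht z, forcing, ← hV]; abel
  rw [hwt]
  have hF : IsWeaklyDivFree (fun y => ∑ p : Fin 3 × Fin 3,
      oseenDuhamel 1 0 (unitField p) (residualField T F p) t y) :=
    isWeaklyDivFree_sum_of_bound _ (fun p _ => (hpf p).isWeaklyDivFree hα hα1 ht)
      (fun p _ => (hpf p).measurable_oseenDuhamel t) (fun p _ y => (hpf p).norm_oseenDuhamel_le hα hα1 ht y)
  have hFm : Measurable (fun y => ∑ p : Fin 3 × Fin 3,
      oseenDuhamel 1 0 (unitField p) (residualField T F p) t y) :=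
    Finset.measurable_sum _ fun p _ => (hpf p).measurable_oseenDuhamel t
  have hFb : ∀ y, ‖∑ p : Fin 3 × Fin 3, oseenDuhamel 1 0 (unitField p) (residualField T F p) t y‖ ≤
      ∑ p : Fin 3 × Fin 3, oseenSliceConst ℝ³ * ((ε₀ + 1) * ((2 / α + 4) * t ^ (α - 1 / 2))) :=
    fun y => norm_sum_le_of_le _ fun p _ => (hpf p).norm_oseenDuhamel_le hα hα1 ht y
  -- the three bilinear terms
  have h1 := hpVw.isWeaklyDivFree hα hα1 ht
  have h2 := hpwV.isWeaklyDivFree hα hα1 ht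
  have h3 := hpww.isWeaklyDivFree hα hα1 ht
  have hm1 := hpVw.measurable_oseenDuhamel t
  have hm2 := hpwV.measurable_oseenDuhamel t
  have hm3 := hpww.measurable_oseenDuhamel t
  have hb1 := hpVw.norm_oseenDuhamel_le hα hα1 ht
  have hb2 := hpwV.norm_oseenDuhamel_le hα hα1 ht
  have hb3 := hpww.norm_oseenDuhamel_le hα hα1 ht
  have hneg : ∀ {u : ℝ³ → ℝ³} {M : ℝ}, (∀ y, ‖u y‖ ≤ M) → ∀ y, ‖(-u) y‖ ≤ M := fun hu y => by
    rw [Pi.neg_apply, norm_neg]; exact hu y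
  have h23 : IsWeaklyDivFree (-(oseenDuhamel 1 0 w V t) + -(oseenDuhamel 1 0 w w t)) :=
    isWeaklyDivFree_add_of_bound (isWeaklyDivFree_neg h2) (isWeaklyDivFree_neg h3)
      hm2.neg.aestronglyMeasurable hm3.neg.aestronglyMeasurable (hneg hb2) (hneg hb3)
  have h123 : IsWeaklyDivFree (-(oseenDuhamel 1 0 V w t) +
      (-(oseenDuhamel 1 0 w V t) + -(oseenDuhamel 1 0 w w t))) :=
    isWeaklyDivFree_add_of_bound (isWeaklyDivFree_neg h1) h23 hm1.neg.aestronglyMeasurable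
      (hm2.neg.add hm3.neg).aestronglyMeasurable (hneg hb1)
      (fun y => (norm_add_le _ _).trans (add_le_add (hneg hb2 y) (hneg hb3 y)))
  exact isWeaklyDivFree_add_of_bound hF h123 hFm.aestronglyMeasurable
    (hm1.neg.add (hm2.neg.add hm3.neg)).aestronglyMeasurable hFb
    (fun y => (norm_add_le _ _).trans (add_le_add (hneg hb1 y)
      ((norm_add_le _ _).trans (add_le_add (hneg hb2 y) (hneg hb3 y)))))

/-- **`u = ṽ + w` descends to a classical solution on `(0,T] × 𝕋³`** (§5 ¶1: "by standard
regularity theory `u⁽ⁱ⁾` is smooth"; `Torus.exists_isClassicalNSSolutionOn_of_oseenMild`).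
[cite: CoiculescuPalasek2025, §5 ¶1; KochNadirashviliSereginSverak2009, §4 Prop. 4.1] -/
theorem IsApproximateSolution.exists_pressure (h : IsApproximateSolution T α κ K C η ε₀ v F π)
    (hT : 0 < T) (hT1 : T ≤ 1) (hα : 0 < α) (hα1 : α ≤ 1 / 2) (hε₀ : 0 ≤ ε₀) (hρ : 0 ≤ ρ)
    (hw : IsCorrection T α ρ v F w) :
    ∃ q : ℝ → 𝕋³ → ℝ, Torus.IsClassicalNSSolutionOn (Ioc 0 T) 1 0
      (fun t x => (liftCut T v + w) t (Torus.repr x)) q := by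
  have hα1' : α ≤ 1 := hα1.trans (by norm_num)
  have hcl := IsClassicalNSSolutionOn.of_torus_holds h.solution
  refine Torus.exists_isClassicalNSSolutionOn_of_oseenMild hT (h.measurable_liftCut.add hw.measurable)
    (fun s hs => ?_) (fun s t hs hst htT x => h.oseenMild_add hT1 hα hα1 hε₀ hρ hw hs hst htT x)
    (fun t ht j y => ?_) (fun s hs => ?_)
  · -- bounded on `[s, T]`
    refine ⟨|K 0| * s ^ (-(1 / 2 : ℝ)) + ρ * s ^ (α - 1 / 2), fun τ hτ y => ?_⟩
    have hτ' : τ ∈ Ioc 0 T := ⟨hs.1.trans_le hτ.1, hτ.2⟩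
    rw [Pi.add_apply]
    refine (norm_add_le _ _).trans (add_le_add ?_ ?_)
    · exact (h.norm_liftCut_le hτ' y).trans ((h.supProfile_le hτ').trans
        (mul_le_mul_of_nonneg_left (Real.rpow_le_rpow_of_nonpos hs.1 hτ.1 (by norm_num)) (abs_nonneg _)))
    · exact (hw.norm_le τ hτ' y).trans
        (mul_le_mul_of_nonneg_left (Real.rpow_le_rpow_of_nonpos hs.1 hτ.1 (by linarith)) hρ)
  · -- periodic
    simp only [Pi.add_apply]
    rw [isLatticePeriodic_liftCut t j y, hw.periodic t j y]
  · -- weakly divergence free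
    have hs' : s ∈ Ioc 0 T := ⟨hs.1, hs.2.le⟩
    have hVs : liftCut T v s = Torus.lift (v s) := liftCut_of_mem hs'
    have hdivV : IsWeaklyDivFree (liftCut T v s) := by
      rw [hVs]
      exact VectorCalculus.IsDivFree.isWeaklyDivFree_holds (hcl.divFree s hs')
        ((hcl.contDiff_velocity hs').of_le (by exact_mod_cast le_top))
    have hVm : Measurable (liftCut T v s) :=
      h.measurable_liftCut.comp (measurable_const.prodMk measurable_id)
    have hwm : Measurable (w s) := hw.measurable.comp (measurable_const.prodMk measurable_id)
    rw [Pi.add_apply]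
    exact isWeaklyDivFree_add_of_bound hdivV (h.isWeaklyDivFree_correction hT1 hα hα1' hε₀ hρ hw hs')
      hVm.aestronglyMeasurable hwm.aestronglyMeasurable (fun y => h.norm_liftCut_le hs' y)
      (fun y => hw.norm_le s hs' y)

end FourPairs

/-! ## The descended correction: zero mean, `Ḣ⁻¹ → 0`, pairings `→ 0` -/

section Descended

variable {T α : ℝ} {κ : ℝ≥0} {K : ℕ → ℝ} {C η ε₀ : ℝ}
  {v : ℝ → 𝕋³ → ℝ³} {F : ℝ → 𝕋³ → (Fin 3 → Fin 3 → ℝ)} {π : ℝ → 𝕋³ → ℝ}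
  {ρ : ℝ} {w : ℝ → ℝ³ → ℝ³} {q : ℝ → 𝕋³ → ℝ}

/-- The descended correction `W(t) = w(t) ∘ repr` lifts back to `w(t)` (periodicity). [folklore] -/
theorem IsCorrection.lift_repr (hw : IsCorrection T α ρ v F w) (t : ℝ) :
    Torus.lift (fun x : 𝕋³ => w t (Torus.repr x)) = w t :=
  Torus.lift_descend_holds (w t) (hw.periodic t)

/-- On `(0,T]`, `U(t) = v(t) + W(t)` pointwise, where `U(t) = u(t) ∘ repr`. [folklore] -/
theorem liftCut_add_repr (w : ℝ → ℝ³ → ℝ³) {t : ℝ} (ht : t ∈ Ioc 0 T) (x : 𝕋³) :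
    (liftCut T v + w) t (Torus.repr x) = v t x + w t (Torus.repr x) := by
  simp only [Pi.add_apply, liftCut_of_mem ht, Torus.lift_apply, Torus.proj_repr]

/-- **The descended correction has continuous slices on `(0,T]`** (`W(t) = U(t) - v(t)` with `U`
classical). [folklore] -/
theorem continuous_correction_repr (h : IsApproximateSolution T α κ K C η ε₀ v F π)
    (hU : Torus.IsClassicalNSSolutionOn (Ioc 0 T) 1 0 (fun t x => (liftCut T v + w) t (Torus.repr x)) q)
    {t : ℝ} (ht : t ∈ Ioc 0 T) : Continuous fun x : 𝕋³ => w t (Torus.repr x) := by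
  have hUc : Continuous fun x : 𝕋³ => (liftCut T v + w) t (Torus.repr x) :=
    (hU.smooth_velocity.isSmooth_slice ht).continuous
  have hvc : Continuous (v t) := h.continuous_slice ht
  have e : (fun x : 𝕋³ => w t (Torus.repr x)) =
      fun x => (liftCut T v + w) t (Torus.repr x) - v t x := by
    funext x; rw [liftCut_add_repr w ht x]; abel
  rw [e]; exact hUc.sub hvc

/-- Continuity of the torus slices of the residual entry fields on `(0,T]`. [folklore] -/
theorem IsApproximateSolution.continuous_residualEntry (h : IsApproximateSolution T α κ K C η ε₀ v F π)
    (p : Fin 3 × Fin 3) {t : ℝ} (ht : t ∈ Ioc 0 T) :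
    Continuous fun x : 𝕋³ => F t x p.1 p.2 • EuclideanSpace.single p.1 (1 : ℝ) :=
  (((continuous_apply p.2).comp ((continuous_apply p.1).comp
    (h.smooth_residual.isSmooth_slice ht).continuous))).smul continuous_const

/-- The lift of the torus slice of the residual entry field is `residualField` on `(0,T]`. [folklore] -/
theorem lift_residualEntry (p : Fin 3 × Fin 3) {t : ℝ} (ht : t ∈ Ioc 0 T) :
    Torus.lift (fun x : 𝕋³ => F t x p.1 p.2 • EuclideanSpace.single p.1 (1 : ℝ)) =
      residualField T F p t := by
  funext z; rw [Torus.lift_apply, residualField_of_mem p ht]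

/-- The lift of the constant unit torus field is `unitField`. [folklore] -/
theorem lift_unitEntry (p : Fin 3 × Fin 3) (t : ℝ) :
    Torus.lift (fun _ : 𝕋³ => EuclideanSpace.single p.2 (1 : ℝ)) = unitField p t := by
  funext z; simp only [Torus.lift_apply, unitField]

/-- **The correction as a sum of Duhamel terms, descended.** [cite: CoiculescuPalasek2025, Prop. 4.3] -/
theorem IsCorrection.repr_eq (hw : IsCorrection T α ρ v F w) {t : ℝ} (ht : t ∈ Ioc 0 T) :
    (fun x : 𝕋³ => w t (Torus.repr x)) =
      (fun x => ∑ p : Fin 3 × Fin 3,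
          oseenDuhamel 1 0 (unitField p) (residualField T F p) t (Torus.repr x)) +
        (-(fun x => oseenDuhamel 1 0 (liftCut T v) w t (Torus.repr x)) +
          (-(fun x => oseenDuhamel 1 0 w (liftCut T v) t (Torus.repr x)) +
            -(fun x => oseenDuhamel 1 0 w w t (Torus.repr x)))) := by
  funext x
  simp only [Pi.add_apply, Pi.neg_apply]
  rw [hw.eq t ht, forcing]; abel

/-- **Zero mean of the correction** (every Duhamel term of periodic fields has zero cell
average). [cite: CoiculescuPalasek2025, §5 (u⁽ⁱ⁾ mean zero), Def. 3.10 / Rmk. 3.11] -/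
theorem IsApproximateSolution.hasZeroMean_correction (h : IsApproximateSolution T α κ K C η ε₀ v F π)
    (hT1 : T ≤ 1) (hα : 0 < α) (hα1 : α ≤ 1) (hε₀ : 0 ≤ ε₀) (hρ : 0 ≤ ρ) (hw : IsCorrection T α ρ v F w)
    (hU : Torus.IsClassicalNSSolutionOn (Ioc 0 T) 1 0 (fun t x => (liftCut T v + w) t (Torus.repr x)) q)
    {t : ℝ} (ht : t ∈ Ioc 0 T) : Torus.HasZeroMean fun x : 𝕋³ => w t (Torus.repr x) := by
  have hpVw := h.isEnvelopePair_vw hρ hw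
  have hpwV := h.isEnvelopePair_wv hρ hw
  have hpww := IsApproximateSolution.isEnvelopePair_ww (v := v) (F := F) hT1 hα hρ hw
  have hpf := fun p => h.isEnvelopePair_forcing hε₀ p
  -- continuity and lift data of the slices
  have hvA : ∀ τ ∈ Ioc 0 T, Continuous (v τ) := fun τ hτ => h.continuous_slice hτ
  have hvL : ∀ τ ∈ Ioc 0 T, Torus.lift (v τ) = liftCut T v τ := fun τ hτ => (liftCut_of_mem hτ).symm
  have hwA : ∀ τ ∈ Ioc 0 T, Continuous fun x : 𝕋³ => w τ (Torus.repr x) := fun τ hτ =>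
    continuous_correction_repr h hU hτ
  have hwL : ∀ τ ∈ Ioc 0 T, Torus.lift (fun x : 𝕋³ => w τ (Torus.repr x)) = w τ := fun τ _ =>
    hw.lift_repr τ
  have heA : ∀ p : Fin 3 × Fin 3, ∀ τ ∈ Ioc 0 T,
      Continuous fun _ : 𝕋³ => EuclideanSpace.single p.2 (1 : ℝ) := fun p τ _ => continuous_const
  -- the four kinds of terms have zero average
  have z1 := hpVw.integral_repr_eq_zero hα hα1 ht hvA hwA hvL hwL
  have z2 := hpwV.integral_repr_eq_zero hα hα1 ht hwA hvA hwL hvL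
  have z3 := hpww.integral_repr_eq_zero hα hα1 ht hwA hwA hwL hwL
  have zf : ∀ p : Fin 3 × Fin 3, ∫ x : 𝕋³,
      oseenDuhamel 1 0 (unitField p) (residualField T F p) t (Torus.repr x) = 0 := fun p =>
    (hpf p).integral_repr_eq_zero hα hα1 ht (heA p) (fun τ hτ => h.continuous_residualEntry p hτ)
      (fun τ _ => lift_unitEntry p τ) (fun τ hτ => lift_residualEntry p hτ)
  have i1 := hpVw.integrable_repr hα hα1 ht
  have i2 := hpwV.integrable_repr hα hα1 ht
  have i3 := hpww.integrable_repr hα hα1 ht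
  have iF : ∀ p : Fin 3 × Fin 3, Integrable (fun x : 𝕋³ =>
      oseenDuhamel 1 0 (unitField p) (residualField T F p) t (Torus.repr x)) volume := fun p =>
    (hpf p).integrable_repr hα hα1 ht
  have iS : Integrable (fun x : 𝕋³ => ∑ p : Fin 3 × Fin 3,
      oseenDuhamel 1 0 (unitField p) (residualField T F p) t (Torus.repr x)) volume :=
    integrable_finsetSum _ fun p _ => iF p
  unfold Torus.HasZeroMean
  rw [hw.repr_eq ht, integral_add' iS (i1.neg.add (i2.neg.add i3.neg)),
    integral_add' i1.neg (i2.neg.add i3.neg), integral_add' i2.neg i3.neg]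
  simp only [integral_neg', z1, z2, z3, neg_zero, add_zero]
  rw [integral_finsetSum _ fun p _ => iF p]
  exact Finset.sum_eq_zero fun p _ => zf p

/-- `Ḣ^s` seminorm of a complexified finite sum of integrable real fields: bounded by the sum
of the seminorms. [folklore] -/
theorem eHomSobolevSeminorm_complexify_sum_le (s : ℝ) {ι : Type*} (S : Finset ι) {f : ι → 𝕋³ → ℝ³}
    (hf : ∀ i ∈ S, Integrable (f i) volume) :
    Torus.eHomSobolevSeminorm s (EuclideanSpace.complexify ∘ fun x => ∑ i ∈ S, f i x) ≤
      ∑ i ∈ S, Torus.eHomSobolevSeminorm s (EuclideanSpace.complexify ∘ f i) := by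
  classical
  induction S using Finset.induction_on with
  | empty =>
    have h0 : (EuclideanSpace.complexify ∘ fun x : 𝕋³ => ∑ i ∈ (∅ : Finset ι), f i x) =
        fun _ => (0 : EuclideanSpace ℂ (Fin 3)) := by funext x; simp
    have hz : Torus.eHomSobolevSeminorm s (fun _ : 𝕋³ => (0 : EuclideanSpace ℂ (Fin 3))) = 0 := by
      unfold Torus.eHomSobolevSeminorm
      have hc : ∀ k : Fin 3 → ℤ, mFourierCoeff (fun _ : 𝕋³ => (0 : EuclideanSpace ℂ (Fin 3))) k = 0 :=
        fun k => by rw [Torus.mFourierCoeff_eq_integral_volume]; simp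
      simp only [hc, enorm_zero, ne_eq, OfNat.ofNat_ne_zero, not_false_eq_true, zero_pow, mul_zero,
        tsum_zero]
      exact ENNReal.zero_rpow_of_pos (by norm_num)
    rw [h0, hz]
    simp
  | insert a S ha ih =>
    have hfa : Integrable (f a) volume := hf a (Finset.mem_insert_self a S)
    have hfS : ∀ i ∈ S, Integrable (f i) volume := fun i hi => hf i (Finset.mem_insert_of_mem hi)
    have hsum : Integrable (fun x => ∑ i ∈ S, f i x) volume := integrable_finsetSum S hfS
    have e : (fun x => ∑ i ∈ insert a S, f i x) = f a + fun x => ∑ i ∈ S, f i x := by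
      funext x; simp [Finset.sum_insert ha]
    rw [e, complexify_comp_add, Finset.sum_insert ha]
    exact (eHomSobolevSeminorm_add_le s (Torus.integrable_complexify_comp hfa)
      (Torus.integrable_complexify_comp hsum)).trans (add_le_add le_rfl (ih hfS))

/-- **The `Ḣ⁻¹` bound of the correction**: `‖W(t)‖_{Ḣ⁻¹(𝕋³)} ≤ c t^α` on `(0,T]` with
`c = 2π·27·(9(ε₀+1) + 2(|K₀|+1)(ρ+1) + (ρ+1)²)/α`. [cite: CoiculescuPalasek2025, proof of Prop. 4.3 (w(t) → 0)] -/
theorem IsApproximateSolution.eHomSobolevSeminorm_correction_le (h : IsApproximateSolution T α κ K C η ε₀ v F π)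
    (hT1 : T ≤ 1) (hα : 0 < α) (hα1 : α ≤ 1) (hε₀ : 0 ≤ ε₀) (hρ : 0 ≤ ρ) (hw : IsCorrection T α ρ v F w)
    (hU : Torus.IsClassicalNSSolutionOn (Ioc 0 T) 1 0 (fun t x => (liftCut T v + w) t (Torus.repr x)) q)
    {t : ℝ} (ht : t ∈ Ioc 0 T) :
    Torus.eHomSobolevSeminorm (-1) (EuclideanSpace.complexify ∘ fun x : 𝕋³ => w t (Torus.repr x)) ≤
      ENNReal.ofReal (2 * Real.pi * 27 *
        ((9 * (ε₀ + 1) + 2 * ((|K 0| + 1) * (ρ + 1)) + (ρ + 1) ^ 2) * (t ^ α / α))) := by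
  have hpVw := h.isEnvelopePair_vw hρ hw
  have hpwV := h.isEnvelopePair_wv hρ hw
  have hpww := IsApproximateSolution.isEnvelopePair_ww (v := v) (F := F) hT1 hα hρ hw
  have hpf := fun p => h.isEnvelopePair_forcing hε₀ p
  have hvA : ∀ τ ∈ Ioc 0 T, Continuous (v τ) := fun τ hτ => h.continuous_slice hτ
  have hvL : ∀ τ ∈ Ioc 0 T, Torus.lift (v τ) = liftCut T v τ := fun τ hτ => (liftCut_of_mem hτ).symm
  have hwA : ∀ τ ∈ Ioc 0 T, Continuous fun x : 𝕋³ => w τ (Torus.repr x) := fun τ hτ =>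
    continuous_correction_repr h hU hτ
  have hwL : ∀ τ ∈ Ioc 0 T, Torus.lift (fun x : 𝕋³ => w τ (Torus.repr x)) = w τ := fun τ _ =>
    hw.lift_repr τ
  have heA : ∀ p : Fin 3 × Fin 3, ∀ τ ∈ Ioc 0 T,
      Continuous fun _ : 𝕋³ => EuclideanSpace.single p.2 (1 : ℝ) := fun p τ _ => continuous_const
  -- the four kinds of terms
  have b1 := hpVw.eHomSobolevSeminorm_repr_le hα hα1 ht hvA hwA hvL hwL
  have b2 := hpwV.eHomSobolevSeminorm_repr_le hα hα1 ht hwA hvA hwL hvL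
  have b3 := hpww.eHomSobolevSeminorm_repr_le hα hα1 ht hwA hwA hwL hwL
  have bf : ∀ p : Fin 3 × Fin 3, Torus.eHomSobolevSeminorm (-1) (EuclideanSpace.complexify ∘ fun x : 𝕋³ =>
      oseenDuhamel 1 0 (unitField p) (residualField T F p) t (Torus.repr x)) ≤
      ENNReal.ofReal (2 * Real.pi * 27 * ((ε₀ + 1) * (t ^ α / α))) := fun p =>
    (hpf p).eHomSobolevSeminorm_repr_le hα hα1 ht (heA p) (fun τ hτ => h.continuous_residualEntry p hτ)
      (fun τ _ => lift_unitEntry p τ) (fun τ hτ => lift_residualEntry p hτ)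
  have i1 := hpVw.integrable_repr hα hα1 ht
  have i2 := hpwV.integrable_repr hα hα1 ht
  have i3 := hpww.integrable_repr hα hα1 ht
  have iF : ∀ p : Fin 3 × Fin 3, Integrable (fun x : 𝕋³ =>
      oseenDuhamel 1 0 (unitField p) (residualField T F p) t (Torus.repr x)) volume := fun p =>
    (hpf p).integrable_repr hα hα1 ht
  have iS : Integrable (fun x : 𝕋³ => ∑ p : Fin 3 × Fin 3,
      oseenDuhamel 1 0 (unitField p) (residualField T F p) t (Torus.repr x)) volume :=
    integrable_finsetSum _ fun p _ => iF p
  have hc : ∀ {f : 𝕋³ → ℝ³}, Integrable f volume →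
      Integrable (EuclideanSpace.complexify ∘ f) volume := fun hf => Torus.integrable_complexify_comp hf
  -- triangle inequality
  have htri : Torus.eHomSobolevSeminorm (-1) (EuclideanSpace.complexify ∘ fun x : 𝕋³ => w t (Torus.repr x)) ≤
      (∑ p : Fin 3 × Fin 3, Torus.eHomSobolevSeminorm (-1) (EuclideanSpace.complexify ∘ fun x : 𝕋³ =>
          oseenDuhamel 1 0 (unitField p) (residualField T F p) t (Torus.repr x))) +
      (Torus.eHomSobolevSeminorm (-1) (EuclideanSpace.complexify ∘ fun x : 𝕋³ =>
          oseenDuhamel 1 0 (liftCut T v) w t (Torus.repr x)) +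
        (Torus.eHomSobolevSeminorm (-1) (EuclideanSpace.complexify ∘ fun x : 𝕋³ =>
            oseenDuhamel 1 0 w (liftCut T v) t (Torus.repr x)) +
          Torus.eHomSobolevSeminorm (-1) (EuclideanSpace.complexify ∘ fun x : 𝕋³ =>
            oseenDuhamel 1 0 w w t (Torus.repr x)))) := by
    rw [hw.repr_eq ht, complexify_comp_add]
    refine (eHomSobolevSeminorm_add_le _ (hc iS) (hc (i1.neg.add (i2.neg.add i3.neg)))).trans ?_
    refine add_le_add (eHomSobolevSeminorm_complexify_sum_le _ _ fun p _ => iF p) ?_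
    rw [complexify_comp_add]
    refine (eHomSobolevSeminorm_add_le _ (hc i1.neg) (hc (i2.neg.add i3.neg))).trans ?_
    rw [complexify_comp_neg, eHomSobolevSeminorm_neg]
    refine add_le_add le_rfl ?_
    rw [complexify_comp_add]
    refine (eHomSobolevSeminorm_add_le _ (hc i2.neg) (hc i3.neg)).trans ?_
    rw [complexify_comp_neg, eHomSobolevSeminorm_neg, complexify_comp_neg, eHomSobolevSeminorm_neg]
  refine htri.trans ?_
  have hS : ∑ p : Fin 3 × Fin 3, Torus.eHomSobolevSeminorm (-1) (EuclideanSpace.complexify ∘ fun x : 𝕋³ =>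
      oseenDuhamel 1 0 (unitField p) (residualField T F p) t (Torus.repr x)) ≤
      ENNReal.ofReal (9 * (2 * Real.pi * 27 * ((ε₀ + 1) * (t ^ α / α)))) := by
    refine (Finset.sum_le_sum fun p _ => bf p).trans (le_of_eq ?_)
    rw [Finset.sum_const, Finset.card_univ, Fintype.card_prod, Fintype.card_fin, nsmul_eq_mul]
    rw [ENNReal.ofReal_mul (by norm_num : (0:ℝ) ≤ 9)]
    norm_num
  have htα : 0 ≤ t ^ α / α := div_nonneg (Real.rpow_nonneg ht.1.le _) hα.le
  have hπ : 0 ≤ 2 * Real.pi * 27 := by positivity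
  have hK0 : 0 ≤ |K 0| + 1 := by positivity
  refine (add_le_add hS (add_le_add b1 (add_le_add b2 b3))).trans (le_of_eq ?_)
  rw [show 2 * Real.pi * 27 * ((9 * (ε₀ + 1) + 2 * ((|K 0| + 1) * (ρ + 1)) + (ρ + 1) ^ 2) * (t ^ α / α)) =
      9 * (2 * Real.pi * 27 * ((ε₀ + 1) * (t ^ α / α))) +
        (2 * Real.pi * 27 * ((|K 0| + 1) * (ρ + 1) * (t ^ α / α)) +
          (2 * Real.pi * 27 * ((|K 0| + 1) * (ρ + 1) * (t ^ α / α)) +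
            2 * Real.pi * 27 * ((ρ + 1) ^ 2 * (t ^ α / α)))) by ring,
    ENNReal.ofReal_add ?_ ?_, ENNReal.ofReal_add ?_ ?_, ENNReal.ofReal_add ?_ ?_]
  all_goals positivity

/-- **`‖W(t)‖_{Ḣ⁻¹} → 0` as `t ↓ 0`.** [cite: CoiculescuPalasek2025, Prop. 4.3 (w⁽ⁱ⁾(t) → 0) and §5] -/
theorem IsApproximateSolution.tendsto_eHomSobolevSeminorm_correction (h : IsApproximateSolution T α κ K C η ε₀ v F π)
    (hT : 0 < T) (hT1 : T ≤ 1) (hα : 0 < α) (hα1 : α ≤ 1) (hε₀ : 0 ≤ ε₀) (hρ : 0 ≤ ρ)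
    (hw : IsCorrection T α ρ v F w)
    (hU : Torus.IsClassicalNSSolutionOn (Ioc 0 T) 1 0 (fun t x => (liftCut T v + w) t (Torus.repr x)) q) :
    Tendsto (fun t => Torus.eHomSobolevSeminorm (-1)
      (EuclideanSpace.complexify ∘ fun x : 𝕋³ => w t (Torus.repr x))) (𝓝[>] 0) (𝓝 0) := by
  set c : ℝ := 2 * Real.pi * 27 * ((9 * (ε₀ + 1) + 2 * ((|K 0| + 1) * (ρ + 1)) + (ρ + 1) ^ 2) / α)
    with hc
  have hup : Tendsto (fun t : ℝ => ENNReal.ofReal (c * t ^ α)) (𝓝[>] 0) (𝓝 0) := by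
    have h1 : Tendsto (fun t : ℝ => c * t ^ α) (𝓝 0) (𝓝 (c * (0 : ℝ) ^ α)) :=
      ((Real.continuous_rpow_const hα.le).tendsto 0).const_mul c
    rw [Real.zero_rpow hα.ne', mul_zero] at h1
    have h2 : Tendsto (fun t : ℝ => ENNReal.ofReal (c * t ^ α)) (𝓝[>] 0) (𝓝 (ENNReal.ofReal 0)) :=
      (ENNReal.continuous_ofReal.tendsto 0).comp (h1.mono_left nhdsWithin_le_nhds)
    rwa [ENNReal.ofReal_zero] at h2
  refine tendsto_of_tendsto_of_tendsto_of_le_of_le' tendsto_const_nhds hup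
    (Eventually.of_forall fun t => zero_le) ?_
  filter_upwards [Ioc_mem_nhdsGT hT] with t ht
  refine (h.eHomSobolevSeminorm_correction_le hT1 hα hα1 hε₀ hρ hw hU ht).trans (le_of_eq ?_)
  congr 1; simp only [hc]; ring

/-- **The pairings `∫⟪W(t), φ⟫ → 0`** for smooth mean-zero test fields (`Ḣ⁻¹–Ḣ¹` duality).
[cite: CoiculescuPalasek2025, §5 (both solutions attain the same datum)] -/
theorem IsApproximateSolution.tendsto_integral_inner_correction (h : IsApproximateSolution T α κ K C η ε₀ v F π)
    (hT : 0 < T) (hT1 : T ≤ 1) (hα : 0 < α) (hα1 : α ≤ 1) (hε₀ : 0 ≤ ε₀) (hρ : 0 ≤ ρ)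
    (hw : IsCorrection T α ρ v F w)
    (hU : Torus.IsClassicalNSSolutionOn (Ioc 0 T) 1 0 (fun t x => (liftCut T v + w) t (Torus.repr x)) q)
    {φ : 𝕋³ → ℝ³} (hφ : Torus.IsSmooth φ) (hφ0 : Torus.HasZeroMean φ) :
    Tendsto (fun t => ∫ x : 𝕋³, ⟪w t (Torus.repr x), φ x⟫) (𝓝[>] 0) (𝓝 0) := by
  -- the `Ḣ¹` size of the test field
  set Sφ : ℝ≥0∞ := (∑' k : Fin 3 → ℤ, ENNReal.ofReal (Torus.freqNormSq k) *
    ‖mFourierCoeff (EuclideanSpace.complexify ∘ φ) k‖ₑ ^ 2) ^ (1 / 2 : ℝ) with hSφ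
  have hSφ_top : Sφ ≠ ⊤ := by
    have hfin := Torus.eSobolevNorm_one_complexify_lt_top hφ
    have hle : Sφ ≤ Torus.eSobolevNorm 1 (EuclideanSpace.complexify ∘ φ) := by
      simp only [hSφ, Torus.eSobolevNorm]
      refine ENNReal.rpow_le_rpow (ENNReal.tsum_le_tsum fun k => mul_le_mul_left ?_ _) (by norm_num)
      have h0 : 0 ≤ 1 + Torus.freqNormSq k := by linarith [Torus.freqNormSq_nonneg k]
      have e : Torus.sobolevWeight 1 k ^ 2 = 1 + Torus.freqNormSq k := by
        rw [Torus.sobolevWeight, ← Real.rpow_natCast, ← Real.rpow_mul h0]; norm_num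
      refine ENNReal.ofReal_le_ofReal ?_
      rw [e]; linarith [Torus.freqNormSq_nonneg k]
    exact (lt_of_le_of_lt hle hfin).ne
  have hφ2 : MemLp φ 2 (volume : Measure 𝕋³) :=
    (memLp_top_of_bound hφ.continuous.aestronglyMeasurable _ (Eventually.of_forall
      (Torus.norm_le_toReal_eSupNorm hφ.continuous))).mono_exponent le_top
  -- the bound `|∫⟪W(t), φ⟫| ≤ ‖W(t)‖_{Ḣ⁻¹} Sφ` on `(0,T]`
  have hbd : ∀ t ∈ Ioc 0 T, ENNReal.ofReal |∫ x : 𝕋³, ⟪w t (Torus.repr x), φ x⟫| ≤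
      Torus.eHomSobolevSeminorm (-1) (EuclideanSpace.complexify ∘ fun x : 𝕋³ => w t (Torus.repr x)) * Sφ := by
    intro t ht
    have hWc : Continuous fun x : 𝕋³ => w t (Torus.repr x) := continuous_correction_repr h hU ht
    have hW2 : MemLp (fun x : 𝕋³ => w t (Torus.repr x)) 2 (volume : Measure 𝕋³) :=
      (memLp_top_of_bound hWc.aestronglyMeasurable _ (Eventually.of_forall
        (Torus.norm_le_toReal_eSupNorm hWc))).mono_exponent le_top
    exact Torus.ofReal_abs_integral_inner_le_eHomSobolevSeminorm_mul hW2 hφ2 hφ0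
  -- the right-hand side tends to `0`
  have hlim := (h.tendsto_eHomSobolevSeminorm_correction hT hT1 hα hα1 hε₀ hρ hw hU)
  have hlim' : Tendsto (fun t => Torus.eHomSobolevSeminorm (-1)
      (EuclideanSpace.complexify ∘ fun x : 𝕋³ => w t (Torus.repr x)) * Sφ) (𝓝[>] 0) (𝓝 0) := by
    have := ENNReal.Tendsto.mul_const hlim (Or.inr hSφ_top)
    rwa [zero_mul] at this
  have hofReal : Tendsto (fun t => ENNReal.ofReal |∫ x : 𝕋³, ⟪w t (Torus.repr x), φ x⟫|) (𝓝[>] 0) (𝓝 0) :=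
    tendsto_of_tendsto_of_tendsto_of_le_of_le' tendsto_const_nhds hlim'
      (Eventually.of_forall fun t => zero_le) (by filter_upwards [Ioc_mem_nhdsGT hT] with t ht; exact hbd t ht)
  have habs : Tendsto (fun t => |∫ x : 𝕋³, ⟪w t (Torus.repr x), φ x⟫|) (𝓝[>] 0) (𝓝 0) := by
    have h1 := (ENNReal.tendsto_toReal ENNReal.zero_ne_top).comp hofReal
    rw [ENNReal.toReal_zero] at h1
    refine h1.congr fun t => ?_
    simp only [Function.comp_apply, ENNReal.toReal_ofReal (abs_nonneg _)]
  exact tendsto_zero_iff_norm_tendsto_zero.2 (by simpa only [Real.norm_eq_abs] using habs)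

end Descended

/-! ## Assembly at fixed data -/

section Assembly

variable {T α : ℝ} {κ : ℝ≥0} {K : ℕ → ℝ} {C η ε₀ : ℝ}
  {v : ℝ → 𝕋³ → ℝ³} {F : ℝ → 𝕋³ → (Fin 3 → Fin 3 → ℝ)} {π : ℝ → 𝕋³ → ℝ}

/-- **The five conclusions of the perturbation step at fixed data.** For an approximate solution
on `(0,T]` (`T ≤ 1`, `0 < α ≤ 1/2`, `ε₀ > 0`, `η ≥ 0`) with `(3θ+1)η ≤ α/2` and
`c_g ε₀ C_R ≤ 1`, there are `w`, `q` with `v + w` classical on `(0,T] × 𝕋³`, `∫ w(t) = 0`,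
`‖w(t)‖_∞ ≤ c_g ε₀ C_R t^{α-1/2}`, `‖w(t)‖_{Ḣ⁻¹} → 0` and `∫⟪w(t), φ⟫ → 0` for smooth mean-zero `φ`.
[cite: CoiculescuPalasek2025, Props. 4.2–4.3 and §5 ¶1] -/
theorem IsApproximateSolution.exists_correction (h : IsApproximateSolution T α κ K C η ε₀ v F π)
    (hT : 0 < T) (hT1 : T ≤ 1) (hα : 0 < α) (hα2 : α ≤ 1 / 2) (hε₀ : 0 < ε₀) (hη : 0 ≤ η)
    (hηs : (3 * theta K C α + 1) * η ≤ α / 2)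
    (hsmall : forcingConst α * ε₀ * resolventBound K C α ≤ 1) :
    ∃ (w : ℝ → 𝕋³ → ℝ³) (q : ℝ → 𝕋³ → ℝ),
      Torus.IsClassicalNSSolutionOn (Ioc 0 T) 1 0 (v + w) q ∧
      (∀ t ∈ Ioc (0 : ℝ) T, Torus.HasZeroMean (w t)) ∧
      (∀ t ∈ Ioc (0 : ℝ) T, ∀ x,
        ‖w t x‖ ≤ forcingConst α * ε₀ * resolventBound K C α * t ^ (α - 1 / 2)) ∧
      Tendsto (fun t => Torus.eHomSobolevSeminorm (-1) (EuclideanSpace.complexify ∘ w t))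
        (𝓝[>] 0) (𝓝 0) ∧
      ∀ φ : 𝕋³ → ℝ³, Torus.IsSmooth φ → Torus.HasZeroMean φ →
        Tendsto (fun t => ∫ x, ⟪w t x, φ x⟫) (𝓝[>] 0) (𝓝 0) := by
  set ρ : ℝ := forcingConst α * ε₀ * resolventBound K C α with hρdef
  have hρ : 0 ≤ ρ := (mul_pos (mul_pos (forcingConst_pos hα) hε₀) (resolventBound_pos K C hα)).le
  have hα1 : α ≤ 1 := hα2.trans (by norm_num)
  obtain ⟨w, hw⟩ := h.exists_isCorrection hT hT1 hα hα2 hε₀ hη hηs hsmall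
  obtain ⟨q, hU⟩ := h.exists_pressure hT hT1 hα hα2 hε₀.le hρ hw
  -- the output correction on the torus: `U(t) - v(t)`, equal to `w(t) ∘ repr` on `(0,T]`
  set wo : ℝ → 𝕋³ → ℝ³ := fun t x => (liftCut T v + w) t (Torus.repr x) - v t x with hwo
  have hsum : v + wo = fun t x => (liftCut T v + w) t (Torus.repr x) := by
    funext t x; simp only [Pi.add_apply, hwo]; abel
  have hwo_eq : ∀ t ∈ Ioc 0 T, wo t = fun x => w t (Torus.repr x) := by
    intro t ht; funext x
    simp only [hwo]
    rw [liftCut_add_repr w ht x]; abel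
  have hev : ∀ᶠ t in 𝓝[>] (0 : ℝ), t ∈ Ioc 0 T := Ioc_mem_nhdsGT hT
  refine ⟨wo, q, hsum ▸ hU, fun t ht => ?_, fun t ht x => ?_, ?_, fun φ hφ hφ0 => ?_⟩
  · rw [hwo_eq t ht]
    exact h.hasZeroMean_correction hT1 hα hα1 hε₀.le hρ hw hU ht
  · rw [hwo_eq t ht]
    exact hw.norm_le t ht _
  · refine (h.tendsto_eHomSobolevSeminorm_correction hT hT1 hα hα1 hε₀.le hρ hw hU).congr' ?_
    filter_upwards [hev] with t ht
    rw [hwo_eq t ht]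
  · refine (h.tendsto_integral_inner_correction hT hT1 hα hα1 hε₀.le hρ hw hU hφ hφ0).congr' ?_
    filter_upwards [hev] with t ht
    simp only [hwo_eq t ht]

end Assembly

end CoiculescuPalasek2025

/-! ## The reduced perturbation step and the barrier from the principal parts alone -/

/-- **Coiculescu–Palasek 2025, Props. 4.2–4.3 — the perturbation step PROVED, reduced form.**
For all `α ∈ (0, 1/8)`, `κ ∈ (0, 1/2 - 4α)`, `K`, `C` there is `C₄ > 0` (here `C₄ = 1`) such that
for every `ε₁ ∈ (0, C₄⁻¹)` there are `ε₀ > 0` and `η > 0` with: every approximate solution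
`(v, F, π)` on `(0, T_*]` with data `(α, κ, K, C, η, ε₀)` admits a correction `w` and a pressure
`q` with `v + w` a classical solution of Navier–Stokes on `(0,T_*] × 𝕋³`, `∫ w(t) = 0`,
`t^{(1-α)/2}‖w(t,x)‖ ≤ ε₁`, `‖w(t)‖_{Ḣ⁻¹} → 0` and `∫⟪w(t), φ⟫ → 0` (`t ↓ 0`) for smooth mean-zero
`φ`. This is hypothesis `hB` of
`CriticalDataSmoothNonuniqueness_of_principalParts_of_perturbationThreshold` with `κ₁` arbitrary
(the Hölder exponent plays no role once the `Ċ^{1,κ}` slot is dropped) — in particular the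
`κ ≤ α` form `…_of_perturbationLe`. Choice of constants: `η = (α/2)/(3θ+1)`,
`ε₀ = ε₁/(c_g C_R)`. [cite: CoiculescuPalasek2025, Props. 4.2–4.3 with App. B, §5 ¶1] -/
theorem CoiculescuPalasek2025_perturbation_reduced :
    ∀ α : ℝ, 0 < α → α < 1 / 8 →
      ∀ κ : ℝ≥0, 0 < κ → (κ : ℝ) < 1 / 2 - 4 * α →
      ∀ (K : ℕ → ℝ) (C : ℝ),
      ∃ C₄ : ℝ, 0 < C₄ ∧
      ∀ ε₁ : ℝ, 0 < ε₁ → ε₁ < C₄⁻¹ →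
      ∃ ε₀ : ℝ, 0 < ε₀ ∧ ∃ η : ℝ, 0 < η ∧
      ∀ (v : ℝ → UnitAddTorus (Fin 3) → EuclideanSpace ℝ (Fin 3))
        (F : ℝ → UnitAddTorus (Fin 3) → (Fin 3 → Fin 3 → ℝ)) (π : ℝ → UnitAddTorus (Fin 3) → ℝ),
        IsApproximateSolution unitTime α κ K C η ε₀ v F π →
        ∃ (w : ℝ → UnitAddTorus (Fin 3) → EuclideanSpace ℝ (Fin 3))
          (q : ℝ → UnitAddTorus (Fin 3) → ℝ),
          Torus.IsClassicalNSSolutionOn (Ioc 0 unitTime) 1 0 (v + w) q ∧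
          (∀ t ∈ Ioc (0 : ℝ) unitTime, Torus.HasZeroMean (w t)) ∧
          (∀ t ∈ Ioc (0 : ℝ) unitTime, ∀ x, t ^ ((1 - α) / 2) * ‖w t x‖ ≤ ε₁) ∧
          Tendsto (fun t => Torus.eHomSobolevSeminorm (-1) (EuclideanSpace.complexify ∘ w t))
            (𝓝[>] 0) (𝓝 0) ∧
          ∀ φ : UnitAddTorus (Fin 3) → EuclideanSpace ℝ (Fin 3), Torus.IsSmooth φ →
            Torus.HasZeroMean φ → Tendsto (fun t => ∫ x, ⟪w t x, φ x⟫) (𝓝[>] 0) (𝓝 0) := by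
  intro α hα hα8 κ _hκ _hκ' K C
  refine ⟨1, one_pos, fun ε₁ hε₁ hε₁1 => ?_⟩
  have hα2 : α ≤ 1 / 2 := by linarith
  have hθ := CoiculescuPalasek2025.theta_nonneg K C hα
  have hcg := CoiculescuPalasek2025.forcingConst_pos hα
  have hCR := CoiculescuPalasek2025.resolventBound_pos K C hα
  set η : ℝ := (α / 2) / (3 * CoiculescuPalasek2025.theta K C α + 1) with hηdef
  set ε₀ : ℝ := ε₁ / (CoiculescuPalasek2025.forcingConst α * CoiculescuPalasek2025.resolventBound K C α)
    with hε₀def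
  have hη : 0 < η := by positivity
  have hε₀ : 0 < ε₀ := by positivity
  have hηs : (3 * CoiculescuPalasek2025.theta K C α + 1) * η ≤ α / 2 := by
    rw [hηdef, mul_div_cancel₀ _ (by positivity)]
  have hρ : CoiculescuPalasek2025.forcingConst α * ε₀ * CoiculescuPalasek2025.resolventBound K C α = ε₁ := by
    rw [hε₀def]; field_simp
  have hsmall : CoiculescuPalasek2025.forcingConst α * ε₀ *
      CoiculescuPalasek2025.resolventBound K C α ≤ 1 := by
    rw [hρ]; rw [inv_one] at hε₁1; exact hε₁1.le
  refine ⟨ε₀, hε₀, η, hη, fun v F π h => ?_⟩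
  obtain ⟨w, q, hU, hmean, hbound, hH, hpair⟩ := h.exists_correction unitTime_pos unitTime_le_one hα
    hα2 hε₀ hη.le hηs hsmall
  refine ⟨w, q, hU, hmean, fun t ht x => ?_, hH, hpair⟩
  have ht1 : t ≤ 1 := ht.2.trans unitTime_le_one
  have h1 := hbound t ht x
  rw [hρ] at h1
  have e1 : t ^ ((1 - α) / 2) * t ^ (α - 1 / 2) = t ^ (α / 2) := by
    rw [← Real.rpow_add ht.1]; congr 1; ring
  have h2 : t ^ (α / 2) ≤ 1 := Real.rpow_le_one ht.1.le ht1 (by linarith)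
  calc t ^ ((1 - α) / 2) * ‖w t x‖ ≤ t ^ ((1 - α) / 2) * (ε₁ * t ^ (α - 1 / 2)) :=
        mul_le_mul_of_nonneg_left h1 (Real.rpow_nonneg ht.1.le _)
    _ = ε₁ * (t ^ ((1 - α) / 2) * t ^ (α - 1 / 2)) := by ring
    _ = ε₁ * t ^ (α / 2) := by rw [e1]
    _ ≤ ε₁ * 1 := mul_le_mul_of_nonneg_left h2 hε₁.le
    _ = ε₁ := mul_one _

/-- **The barrier fact from the principal parts alone.** With the perturbation step proved
(`CoiculescuPalasek2025_perturbation_reduced`), the only remaining hypothesis of the tree's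
assembly of Thm. 1.2 is the principal-parts conclusion `hA` (Def. 3.10, Prop. 3.13, Prop. 4.1
and the `v⁽ⁱ⁾`-only estimates of §5 — verbatim the hypothesis of
`CoiculescuPalasek2025_construction_of_parts`). [cite: CoiculescuPalasek2025, Thm. 1.2 and §5] -/
theorem CriticalDataSmoothNonuniqueness_of_principalParts
    (hA : ∀ α : ℝ, 0 < α → α < 1 / 8 →
      ∃ κ : ℝ≥0, 0 < κ ∧ (κ : ℝ) < 1 / 2 - 4 * α ∧
      ∃ (K : ℕ → ℝ) (C : ℝ),
      ∀ (ε₀ η L δ : ℝ), 0 < ε₀ → 0 < η → 0 < δ →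
      ∃ (v₁ v₂ : ℝ → UnitAddTorus (Fin 3) → EuclideanSpace ℝ (Fin 3))
        (F₁ F₂ : ℝ → UnitAddTorus (Fin 3) → (Fin 3 → Fin 3 → ℝ))
        (π₁ π₂ : ℝ → UnitAddTorus (Fin 3) → ℝ),
        IsApproximateSolution unitTime α κ K C η ε₀ v₁ F₁ π₁ ∧
        IsApproximateSolution unitTime α κ K C η ε₀ v₂ F₂ π₂ ∧
        (∃ t₀ ∈ Ioc (0 : ℝ) unitTime, ∃ x₀ : UnitAddTorus (Fin 3),
          L ≤ t₀ ^ ((1 - α) / 2) * ‖v₁ t₀ x₀ - v₂ t₀ x₀‖) ∧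
        Tendsto (fun t =>
            Torus.eHomSobolevSeminorm (-1) (EuclideanSpace.complexify ∘ (v₁ t - v₂ t)))
          (𝓝[>] 0) (𝓝 0) ∧
        Tendsto (fun st : ℝ × ℝ =>
            Torus.eHomSobolevSeminorm (-1) (EuclideanSpace.complexify ∘ (v₁ st.1 - v₁ st.2)))
          ((𝓝[>] (0 : ℝ)) ×ˢ (𝓝[>] (0 : ℝ))) (𝓝 0) ∧
        Tendsto (fun st : ℝ × ℝ =>
            Torus.eHomSobolevSeminorm (-1) (EuclideanSpace.complexify ∘ (v₂ st.1 - v₂ st.2)))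
          ((𝓝[>] (0 : ℝ)) ×ˢ (𝓝[>] (0 : ℝ))) (𝓝 0) ∧
        (∀ φ : UnitAddTorus (Fin 3) → EuclideanSpace ℝ (Fin 3), Torus.IsSmooth φ →
          Torus.HasZeroMean φ →
          ∃ c : ℝ, Tendsto (fun t => ∫ x, ⟪v₁ t x, φ x⟫) (𝓝[>] 0) (𝓝 c) ∧
            Tendsto (fun t => ∫ x, ⟪v₂ t x, φ x⟫) (𝓝[>] 0) (𝓝 c)) ∧
        (∀ x, ‖v₁ unitTime x‖ ≤ δ ∧ ‖v₂ unitTime x‖ ≤ δ)) :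
    CriticalDataSmoothNonuniqueness :=
  CriticalDataSmoothNonuniqueness_of_principalParts_of_perturbationLe hA
    fun α hα hα' κ hκ hκ' _ K C => CoiculescuPalasek2025_perturbation_reduced α hα hα' κ hκ hκ' K C


end Literature.Barriers.NavierStokesRegularity
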